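import Mathlib
import Literature.NumberTheory.LFunctions.Zhang2022.Section12Ded1217Splits
import Literature.NumberTheory.LFunctions.Zhang2022.TypedSection12B
import Literature.NumberTheory.LFunctions.Zhang2022.Section10RangeToolkit
import Literature.NumberTheory.LFunctions.Zhang2022.Section10cExpandSplit
import Literature.NumberTheory.LFunctions.Zhang2022.Section10TruncationBridges
import HarnessLib

/-!
# Zhang (2022) §12c: the middle range `P″₁/T < dr ≤ P″₁` of `S_j(𝐚₁₂,𝐚₂₅)` is `o(α)` — the leaf
# `Typed.Sec12C.Mid1225` as an EDGE from (12.11) and Lemma 8.2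

Topic `Literature/NumberTheory/LFunctions/Zhang2022` (Landau–Siegel audit tree; verdict-neutral).
Y. Zhang, *Discrete mean estimates and the Landau–Siegel zero*, arXiv:2211.02515v1 (2022)
[Zhang2022LandauSiegel] — **an unrefereed manuscript under adjudication; this theorem-only file
(ZHANG-L discharge lane, WP12) asserts nothing about its Theorems 1–2 and nothing about
Landau–Siegel zeros.** It proves the un-displayed sentence preceding (12.12) [Z22 p.71, tex L3605]

> "The sum is split into three sums according to `dr ≤ P″₁/T`, `P″₁/T < dr ≤ P″₁` and
> `P″₁ < dr < P₂`. By lemma 8.2, 8.3 and 12.1, the sum over `P″₁/T < dr ≤ P″₁` contributes `o(α)`"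

(typed by L3-t9 as `Typed.Sec12C.Mid1225 c′`, a hypothesis `hMid` of
`Skeleton.theorem1_of_leaves_v19`) as an EDGE THEOREM from exactly the two inputs the printed
argument consumes: Lemma 8.2 (a theorem of the tree for `c′ ≥ 0`, `Skeleton.lemma82_holds`) for the
`m`-sum, and the bound (12.11) of Lemma 12.2 for the `n`-sum ("12.1" in the sentence is read 12.2:
the `n`-sum carries `ϰ̄₁₃ξⱼ`, the object of (12.11); (12.11) has no proof in print — "The proof of
(12.11) is similar to that of ." [sic], tex L3549, GAP row G-L3t5-2 — and enters here as a
HYPOTHESIS, in the typed form `Typed.Sec12B.Eq1211 c′` for `mid1225_of_eq1211` and in a weaker inline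
form for `mid1225_of_eq1211_weak`).

## The printed argument, made quantitative

With `n = dr` and the weight `|μ(r)|λ₀ⱼ(n)/(nφ(r))` of `S_j` (Prop. 7.1, `Skeleton.Sj`; restricted sum
`Typed.Sec12C.SjOn … (rngMid D)`), the `(d,r)`-term is `weight·M·N` where

* `M = Σ_m 𝐚₁₂(drm)m^{β_j−1} = χ(d)χ(r)·mSum12` (`Typed.Sec10C.mSum_a12_eq`) and
  `mSum12 = (ῑ₃/log P₃)Σ⁽⁸·²⁾(μ=6, x=P₃/n) + (ῑ₄/log P₂)Σ⁽⁸·²⁾(μ=7, x=P₂/n)` EXACTLY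
  (`mSum12_eq_lemma82_sums`; `ϰ₃(k) = (log(P₃/k)/log P₃)(P₃/k)^{β₆}`, (8.6)); for `1 ≤ n ≤ P″₁` both
  arguments lie in `(T, P)` (`mid_window3`, `mid_window2`), so Lemma 8.2 and the trivial
  `|L′(1,χ)| ≤ 4e^{9/2}𝓛²` (`Lemma31.norm_deriv_LFunction_le_near_one`), `|𝔣_{jμ}| ≤ F₀(c′)`
  (`norm_frakfW_le`) give `‖mSum12‖ ≤ K_M(c′)·𝓛⁻⁷` (`norm_mSum12_le`);
* `N = Σ_n 𝐚₂₅(drn)ξ₀ⱼ(n;d,r)/n = χ(d)χ(r)·sum122` (`nSum_a25_eq_sum122`; `ϰ₁₃` is supported below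
  `P″₂ ≤ PT⁻²`), bounded by (12.11);
* weights: `‖λ₀ⱼ(n)‖ ≤ (n/φ(n))⁴` (`Skeleton.norm_lamZero_le`), `Σ_{r∣n sqfree}φ(r)⁻¹ = n/φ(n)`,
  `Σ_{Y<n≤X}(n/φ(n))⁹/n ≤ e^{1024}(1 + log X − log Y)` (`Skeleton.sum_ratio_pow_div_le`), and the
  range has logarithmic length `log T = 𝓛^{1.1}`.

Altogether `‖S_j|_{mid}‖ ≤ K_M·C·e^{1024}(3 + 𝓛²)·𝓛^{−12} = o(𝓛⁻⁹) = o(α)` (`α = π𝓛⁻⁹`): the room is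
`𝓛²` even with (12.11) weakened to `C𝓛⁻⁵(dr/φ(dr))⁴` (the typed `Eq1211` has `Cα𝓛 = Cπ𝓛⁻⁸`).
No new definition, no named fact; standard axioms. What this is NOT: a proof of (12.11) (that
is the follow-up, "similar to Lemma 8.4", from the relative Lemmas 8.3/8.4), nor a statement about
(12.12)–(12.17).

## References

* Y. Zhang, arXiv:2211.02515v1 (2022), §12 p.71 (tex L3605), Lemma 12.2 (12.11) p.70, Lemma 8.2
  p.45, (8.6) p.44, §7 Prop. 7.1 p.33. [cite: Zhang2022LandauSiegel, §12 (12.12) p.71]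
* R. R. Hall, G. Tenenbaum, *Divisors*, CUP 1988, §0.2. [cite: HallTenenbaum1988, §0.2]
-/

noncomputable section

open Complex Real ComplexConjugate
open Literature.NumberTheory.LFunctions.Zhang2022
open Literature.NumberTheory.LFunctions.Zhang2022.Skeleton

namespace Literature.NumberTheory.LFunctions.Zhang2022.Typed.Sec12C

open Literature.NumberTheory.LFunctions.Zhang2022.Typed.Sec12B (sum122 Eq1211)
open Literature.NumberTheory.LFunctions.Zhang2022.Typed.Sec10C (mSum12 mSum_a12_eq
  conj_eq_self_of_isQuadratic)

/-! ### Sizes of the parameters -/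

section Sizes

/-- `log D ≥ L` once `D ≥ ⌈e^L⌉`. [folklore] -/
private theorem le_ell_of_ceil_exp_le {L : ℝ} {D : ℕ} (hD : ⌈Real.exp L⌉₊ ≤ D) : L ≤ ell D := by
  rw [ell]
  have hD' : Real.exp L ≤ (D : ℝ) := (Nat.le_ceil _).trans (by exact_mod_cast hD)
  have hpos : (0 : ℝ) < D := (Real.exp_pos L).trans_le hD'
  exact (Real.le_log_iff_exp_le hpos).mpr hD'

/-- `𝓛^{1.1} ≤ 𝓛²` for `𝓛 ≥ 1`. [folklore] -/
private theorem ell_rpow_le_sq {D : ℕ} (h1 : 1 ≤ ell D) : ell D ^ (1.1 : ℝ) ≤ ell D ^ 2 := by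
  have h : ell D ^ (1.1 : ℝ) ≤ ell D ^ (2 : ℝ) :=
    Real.rpow_le_rpow_of_exponent_le h1 (by norm_num)
  simpa using h

/-- `log T = 𝓛^{1.1}`. [cite: Zhang2022LandauSiegel, §6 p.30] -/
private theorem log_bigT' (D : ℕ) : Real.log (bigT D) = ell D ^ (1.1 : ℝ) := by
  rw [bigT, Real.log_exp]

/-- `log P₃ = 0.498·𝓛⁹`. [cite: Zhang2022LandauSiegel, §2 (2.21)] -/
private theorem log_P3 (D : ℕ) : Real.log (P3 D) = 0.498 * ell D ^ 9 := by
  rw [P3, Real.log_rpow (bigP_pos D), Skeleton.log_bigP]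

/-- `log P₂ = 0.5·𝓛⁹ − 10·𝓛^{1.1}`. [cite: Zhang2022LandauSiegel, §2 (2.21)] -/
private theorem log_P2 (D : ℕ) :
    Real.log (Skeleton.P2 D) = 0.5 * ell D ^ 9 - 10 * ell D ^ (1.1 : ℝ) := by
  have hP : 0 < bigP D := bigP_pos D
  have hT : 0 < bigT D := Real.exp_pos _
  rw [Skeleton.P2, Real.log_div (Real.rpow_pos_of_pos hP _).ne' (pow_pos hT _).ne',
    Real.log_rpow hP, Skeleton.log_bigP, Real.log_pow, log_bigT']
  ring

/-- `1 ≤ D·t₀ ≤ e^{520𝓛}` for `𝓛 ≥ 1`. [cite: Zhang2022LandauSiegel, §2 (2.8)] -/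
private theorem D_mul_t0_bounds {D : ℕ} (h1 : 1 ≤ ell D) :
    1 ≤ (D : ℝ) * t0 D ∧ (D : ℝ) * t0 D ≤ Real.exp (520 * ell D) := by
  have h1' : 1 ≤ Real.log D := by rwa [ell] at h1
  have hD : (D : ℝ) = Real.exp (ell D) := Sec12D.natCast_eq_exp_ell h1'
  have ht0 : t0 D ≤ Real.exp (519 * ell D) := Sec12D.t0_le_exp h1'
  have ht1 : 1 ≤ t0 D := by rw [t0]; exact one_le_pow₀ h1
  have hD1 : 1 ≤ (D : ℝ) := by rw [hD]; exact Real.one_le_exp (by linarith)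
  refine ⟨by nlinarith, ?_⟩
  calc (D : ℝ) * t0 D ≤ Real.exp (ell D) * Real.exp (519 * ell D) := by
        rw [hD]; gcongr
    _ = Real.exp (520 * ell D) := by rw [← Real.exp_add]; ring_nf

/-- `P₃ > 1`, `P₃ ≤ P/T²`, `P₂ > 1`, `P₂ ≤ P/T²` for `𝓛 ≥ 3`. [cite: Zhang2022LandauSiegel, §2 (2.21)] -/
private theorem P3_P2_facts {D : ℕ} (hℓ : 3 ≤ ell D) :
    1 < P3 D ∧ P3 D ≤ bigP D / bigT D ^ 2 ∧ 1 < Skeleton.P2 D ∧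
      Skeleton.P2 D ≤ bigP D / bigT D ^ 2 := by
  have h1 : 1 ≤ ell D := by linarith
  have h0 : 0 < ell D := by linarith
  have hP : 0 < bigP D := bigP_pos D
  have hP1 : 1 < bigP D := by rw [bigP]; exact Real.one_lt_exp_iff.mpr (by positivity)
  have h504 := Sec10B.rpow504_le_nsuppBound hℓ
  refine ⟨?_, ?_, ?_, ?_⟩
  · rw [P3]; exact Real.one_lt_rpow hP1 (by norm_num)
  · exact (Real.rpow_le_rpow_of_exponent_le hP1.le (by norm_num : (0.498 : ℝ) ≤ 0.504)).trans h504
  · have hP2pos : 0 < Skeleton.P2 D := by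
      rw [Skeleton.P2]; exact div_pos (Real.rpow_pos_of_pos hP _) (pow_pos (Real.exp_pos _) _)
    have hlog : 0 < Real.log (Skeleton.P2 D) := by
      rw [log_P2]
      have h11 := ell_rpow_le_sq h1
      have h7 : (3 : ℝ) ^ 7 ≤ ell D ^ 7 := pow_le_pow_left₀ (by norm_num) hℓ 7
      nlinarith [pow_nonneg h0.le 2]
    by_contra h
    have := Real.log_nonpos hP2pos.le (not_lt.mp h)
    linarith
  · calc Skeleton.P2 D ≤ bigP D ^ (0.5 : ℝ) := by
          rw [Skeleton.P2]
          exact div_le_self (Real.rpow_nonneg hP.le _)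
            (one_le_pow₀ (Real.one_le_exp (Real.rpow_nonneg h0.le _)))
      _ ≤ bigP D ^ (0.504 : ℝ) := Real.rpow_le_rpow_of_exponent_le hP1.le (by norm_num)
      _ ≤ _ := h504

/-- `P″₁ = P^{0.496}·Dt₀` as an exponential: `P″₁ = exp(0.496𝓛⁹)·(Dt₀)` with
`1 ≤ Dt₀ ≤ e^{520𝓛}`; consequences for `𝓛 ≥ 5`: `T ≤ P″₁`, `T·P″₁ < P₃`, `T·P″₁ < P₂`, `P″₁ < P″₂`.
[cite: Zhang2022LandauSiegel, §12 p.67] -/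
private theorem P1pp_facts {D : ℕ} (hℓ5 : 5 ≤ ell D) :
    bigT D ≤ P1pp D ∧ bigT D * P1pp D < P3 D ∧ bigT D * P1pp D < Skeleton.P2 D ∧
      P1pp D < P2pp D := by
  have h1 : 1 ≤ ell D := by linarith
  have h0 : 0 < ell D := by linarith
  obtain ⟨hDt1, hDt⟩ := D_mul_t0_bounds h1
  have hP : 0 < bigP D := bigP_pos D
  have hT0 : 0 < bigT D := Real.exp_pos _
  have h496 : bigP D ^ (0.496 : ℝ) = Real.exp (0.496 * ell D ^ 9) := by
    rw [bigP, ← Real.exp_mul]; ring_nf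
  have h498 : P3 D = Real.exp (0.498 * ell D ^ 9) := by
    rw [P3, bigP, ← Real.exp_mul]; ring_nf
  have h5 : bigP D ^ (0.5 : ℝ) = Real.exp (0.5 * ell D ^ 9) := by
    rw [bigP, ← Real.exp_mul]; ring_nf
  have hP1pp : P1pp D = Real.exp (0.496 * ell D ^ 9) * ((D : ℝ) * t0 D) := by
    rw [P1pp, h496]; ring
  have h11 := ell_rpow_le_sq h1
  have h7 : (5 : ℝ) ^ 7 ≤ ell D ^ 7 := pow_le_pow_left₀ (by norm_num) hℓ5 7
  have hrp0 : 0 ≤ ell D ^ (1.1 : ℝ) := Real.rpow_nonneg h0.le _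
  refine ⟨?_, ?_, ?_, ?_⟩
  · -- `T ≤ P^{0.496} ≤ P″₁`
    rw [hP1pp, bigT]
    calc Real.exp (ell D ^ (1.1 : ℝ)) ≤ Real.exp (0.496 * ell D ^ 9) := by
          rw [Real.exp_le_exp]; nlinarith [pow_nonneg h0.le 2]
      _ = Real.exp (0.496 * ell D ^ 9) * 1 := (mul_one _).symm
      _ ≤ Real.exp (0.496 * ell D ^ 9) * ((D : ℝ) * t0 D) := by gcongr
  · -- `T·P″₁ ≤ exp(𝓛^{1.1} + 0.496𝓛⁹ + 520𝓛) < exp(0.498𝓛⁹)`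
    rw [hP1pp, h498, bigT]
    calc Real.exp (ell D ^ (1.1 : ℝ)) * (Real.exp (0.496 * ell D ^ 9) * ((D : ℝ) * t0 D))
        ≤ Real.exp (ell D ^ (1.1 : ℝ)) * (Real.exp (0.496 * ell D ^ 9) * Real.exp (520 * ell D)) := by
          gcongr
      _ = Real.exp (ell D ^ (1.1 : ℝ) + 0.496 * ell D ^ 9 + 520 * ell D) := by
          rw [← Real.exp_add, ← Real.exp_add]; ring_nf
      _ < Real.exp (0.498 * ell D ^ 9) := by
          rw [Real.exp_lt_exp]; nlinarith [pow_nonneg h0.le 2]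
  · -- `T·P″₁ < P₂ = P^{0.5}/T^{10}` iff `T^{11}P″₁ < P^{0.5}`
    rw [hP1pp, Skeleton.P2, h5, lt_div_iff₀ (pow_pos hT0 10)]
    have hT11 : bigT D * (Real.exp (0.496 * ell D ^ 9) * ((D : ℝ) * t0 D)) * bigT D ^ 10 =
        Real.exp (11 * ell D ^ (1.1 : ℝ) + 0.496 * ell D ^ 9) * ((D : ℝ) * t0 D) := by
      have e : Real.exp (11 * ell D ^ (1.1 : ℝ) + 0.496 * ell D ^ 9) =
          Real.exp (ell D ^ (1.1 : ℝ)) * Real.exp (0.496 * ell D ^ 9) *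
            Real.exp (10 * ell D ^ (1.1 : ℝ)) := by
        rw [← Real.exp_add, ← Real.exp_add]; ring_nf
      rw [e, bigT, ← Real.exp_nat_mul]; push_cast; ring
    rw [hT11]
    calc Real.exp (11 * ell D ^ (1.1 : ℝ) + 0.496 * ell D ^ 9) * ((D : ℝ) * t0 D)
        ≤ Real.exp (11 * ell D ^ (1.1 : ℝ) + 0.496 * ell D ^ 9) * Real.exp (520 * ell D) := by
          gcongr
      _ = Real.exp (11 * ell D ^ (1.1 : ℝ) + 0.496 * ell D ^ 9 + 520 * ell D) := by
          rw [← Real.exp_add]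
      _ < Real.exp (0.5 * ell D ^ 9) := by
          rw [Real.exp_lt_exp]; nlinarith [pow_nonneg h0.le 2]
  · -- `P″₁ < P″₂`
    rw [P1pp, P2pp]
    have hDt0 : 0 < (D : ℝ) * t0 D := by linarith
    have hP1 : 1 < bigP D := by rw [bigP]; exact Real.one_lt_exp_iff.mpr (by positivity)
    have : bigP D ^ (0.496 : ℝ) < bigP D ^ (0.5 : ℝ) :=
      Real.rpow_lt_rpow_of_exponent_lt hP1 (by norm_num)
    calc bigP D ^ (0.496 : ℝ) * D * t0 D = bigP D ^ (0.496 : ℝ) * ((D : ℝ) * t0 D) := by ring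
      _ < bigP D ^ (0.5 : ℝ) * ((D : ℝ) * t0 D) := by gcongr
      _ = bigP D ^ (0.5 : ℝ) * D * t0 D := by ring

/-- **The Lemma 8.2 windows on the range `dr ≤ P″₁`**: for `1 ≤ n ≤ P″₁` (`𝓛 ≥ 5`),
`T < P₃/n < P` and `T < P₂/n < P`. [cite: Zhang2022LandauSiegel, §12 p.71] -/
private theorem mid_windows {D n : ℕ} (hℓ5 : 5 ≤ ell D) (hn : 1 ≤ n) (hnP : (n : ℝ) ≤ P1pp D) :
    (bigT D < P3 D / n ∧ P3 D / n < bigP D) ∧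
      (bigT D < Skeleton.P2 D / n ∧ Skeleton.P2 D / n < bigP D) := by
  have hℓ3 : 3 ≤ ell D := by linarith
  obtain ⟨-, hT3, hT2, -⟩ := P1pp_facts hℓ5
  obtain ⟨hP3, -, hP2, -⟩ := P3_P2_facts hℓ3
  have hP1 : 1 < bigP D := by
    rw [bigP]; exact Real.one_lt_exp_iff.mpr (pow_pos (by linarith) 9)
  have hn0 : (0 : ℝ) < n := by exact_mod_cast hn
  have hn1 : (1 : ℝ) ≤ n := by exact_mod_cast hn
  have hT0 : 0 < bigT D := Real.exp_pos _
  refine ⟨⟨?_, ?_⟩, ⟨?_, ?_⟩⟩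
  · rw [lt_div_iff₀ hn0]
    calc bigT D * n ≤ bigT D * P1pp D := by gcongr
      _ < P3 D := hT3
  · refine (div_le_self (zero_le_one.trans hP3.le) hn1).trans_lt ?_
    rw [P3]; exact Real.rpow_lt_self_of_one_lt hP1 (by norm_num)
  · rw [lt_div_iff₀ hn0]
    calc bigT D * n ≤ bigT D * P1pp D := by gcongr
      _ < Skeleton.P2 D := hT2
  · refine (div_le_self (zero_le_one.trans hP2.le) hn1).trans_lt ?_
    calc Skeleton.P2 D ≤ bigP D ^ (0.5 : ℝ) := Sec10C.P2_le_sqrtP D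
      _ < bigP D := Real.rpow_lt_self_of_one_lt hP1 (by norm_num)

end Sizes

/-! ### The `m`-sum of `S_j(𝐚₁₂,·)` in terms of the two sums of Lemma 8.2 -/

section MSum

variable (c' : ℝ) {D : ℕ} (χ : DirichletCharacter ℂ D)

omit χ in
/-- `ϰ₃(k) = (log(P₃/k)/log P₃)·(P₃/k)^{β₆}` for `1 ≤ k < P₃` ((8.6): `ϰ₃(k) = (1 − log k/log P₃)(P₃/k)^{β₆}`).
[cite: Zhang2022LandauSiegel, §8 (8.6)] -/
private theorem vk3_eq_of_lt {k : ℕ} (hP3 : 1 < P3 D) (hk0 : 0 < k) (hk : (k : ℝ) < P3 D) :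
    vk3 D k = ((Real.log (P3 D / k) / Real.log (P3 D) : ℝ) : ℂ) * ((P3 D / k : ℝ) : ℂ) ^ (betaMu D 6) := by
  have hk0' : (0 : ℝ) < k := by exact_mod_cast hk0
  have hP30 : 0 < P3 D := by linarith
  have hlog : Real.log (P3 D) ≠ 0 := (Real.log_pos hP3).ne'
  have hβ : betaMu D 6 = beta6 D := by simp [betaMu]
  rw [vk3, if_pos hk, hβ]
  congr 2
  rw [Real.log_div hP30.ne' hk0'.ne']
  field_simp

omit χ in
/-- `ϰ₂(k) = (log(P₂/k)/log P₂)·(P₂/k)^{β₇}` for `1 ≤ k < P₂` ((8.6)). [cite: Zhang2022LandauSiegel, §8 (8.6)] -/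
private theorem vk2_eq_of_lt {k : ℕ} (hP2 : 1 < Skeleton.P2 D) (hk0 : 0 < k)
    (hk : (k : ℝ) < Skeleton.P2 D) :
    vk2 D k = ((Real.log (Skeleton.P2 D / k) / Real.log (Skeleton.P2 D) : ℝ) : ℂ) *
        ((Skeleton.P2 D / k : ℝ) : ℂ) ^ (betaMu D 7) := by
  have hk0' : (0 : ℝ) < k := by exact_mod_cast hk0
  have hP20 : 0 < Skeleton.P2 D := by linarith
  have hlog : Real.log (Skeleton.P2 D) ≠ 0 := (Real.log_pos hP2).ne'
  have hβ : betaMu D 7 = beta7 D := by simp [betaMu]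
  rw [vk2, if_pos hk, hβ]
  congr 2
  rw [Real.log_div hP20.ne' hk0'.ne']
  field_simp

/-- The truncation-and-rescaling step for the `m`-sum: for `X ≤ P/T²` (`X > 1`) and `y = X/(dr)`,
`Σ_{m<⌈PT⁻²⌉} χ(m)·c(drm)·m^{β_j−1} = (log X)⁻¹·Σ_{m<⌈y⌉} χ(m)m^{β_j−1}(y/m)^{β}log(y/m)` when
`c(k) = (log(X/k)/log X)(X/k)^{β}` for `k < X` and `c(k) = 0` for `k ≥ X` — the right side is the sum
of Lemma 8.2 at `x = y`. [cite: Zhang2022LandauSiegel, §8 (8.6), Lemma 8.2] -/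
private theorem sum_rescale82 (j d r : ℕ) (hd : 0 < d) (hr : 0 < r) {X : ℝ} (hX1 : 1 < X)
    (hXN : X ≤ bigP D / bigT D ^ 2) (β : ℂ) (c : ℕ → ℂ)
    (hc_lt : ∀ k : ℕ, 0 < k → (k : ℝ) < X →
      c k = ((Real.log (X / k) / Real.log X : ℝ) : ℂ) * ((X / k : ℝ) : ℂ) ^ β)
    (hc_ge : ∀ k : ℕ, X ≤ (k : ℝ) → c k = 0) :
    ∑ m ∈ Finset.Ico 1 (Nsupp D), χ (m : ZMod D) * c (d * r * m) / (m : ℂ) ^ (1 - betaJ c' D j) =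
      (1 / (Real.log X : ℂ)) * ∑ m ∈ Finset.Ico 1 ⌈X / ((d * r : ℕ) : ℝ)⌉₊,
        χ (m : ZMod D) / (m : ℂ) ^ (1 - betaJ c' D j) *
          ((X / ((d * r : ℕ) : ℝ) / m : ℝ) : ℂ) ^ β * (Real.log (X / ((d * r : ℕ) : ℝ) / m) : ℂ) := by
  have hdr0 : (0 : ℝ) < ((d * r : ℕ) : ℝ) := by exact_mod_cast Nat.mul_pos hd hr
  have hdr1 : (1 : ℝ) ≤ ((d * r : ℕ) : ℝ) := by exact_mod_cast Nat.mul_pos hd hr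
  set y : ℝ := X / ((d * r : ℕ) : ℝ) with hy
  have hyX : y ≤ X := div_le_self (by linarith) hdr1
  have hsub : Finset.Ico 1 ⌈y⌉₊ ⊆ Finset.Ico 1 (Nsupp D) := by
    refine Finset.Ico_subset_Ico_right ?_
    rw [Nsupp]
    exact Nat.ceil_mono (hyX.trans hXN)
  rw [Finset.mul_sum, ← Finset.sum_subset hsub]
  · refine Finset.sum_congr rfl fun m hm => ?_
    rw [Finset.mem_Ico] at hm
    have hm0 : 0 < m := hm.1
    have hm0' : (0 : ℝ) < m := by exact_mod_cast hm0
    have hmy : (m : ℝ) < y := Nat.lt_ceil.mp hm.2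
    have hk : ((d * r * m : ℕ) : ℝ) < X := by
      rw [hy, lt_div_iff₀ hdr0] at hmy
      push_cast at hmy ⊢
      linarith [hmy]
    have hkpos : 0 < d * r * m := Nat.mul_pos (Nat.mul_pos hd hr) hm0
    rw [hc_lt _ hkpos hk]
    have hXk : X / ((d * r * m : ℕ) : ℝ) = y / m := by
      rw [hy]; push_cast; rw [div_div]
    rw [hXk]
    have hlogX : (Real.log X : ℂ) ≠ 0 := by
      exact_mod_cast (Real.log_pos hX1).ne'
    push_cast
    field_simp
  · intro m hm hm'
    rw [Finset.mem_Ico] at hm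
    have hmy : y ≤ (m : ℝ) := by
      by_contra h
      exact hm' (Finset.mem_Ico.mpr ⟨hm.1, Nat.lt_ceil.mpr (not_le.mp h)⟩)
    have hk : X ≤ ((d * r * m : ℕ) : ℝ) := by
      rw [hy, div_le_iff₀ hdr0] at hmy
      push_cast at hmy ⊢
      linarith [hmy]
    rw [hc_ge _ hk]
    simp

/-- **The `m`-sum of `S_j(𝐚₁₂,·)` is a combination of two sums of Lemma 8.2** (exact, `𝓛 ≥ 3`,
`d, r ≥ 1`): `Σ_m χ(m)(ῑ₃ϰ₃(drm) + ῑ₄ϰ₂(drm))m^{β_j−1}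
 = (ῑ₃/log P₃)·Σ_{m<P₃/dr} χ(m)m^{β_j−1}(x₃/m)^{β₆}log(x₃/m) + (ῑ₄/log P₂)·Σ_{m<P₂/dr} (…)(x₂/m)^{β₇}log(x₂/m)`,
`x₃ = P₃/(dr)`, `x₂ = P₂/(dr)` — the sums of `Skeleton.Lemma82` at `μ = 6, y = x₃` and `μ = 7, y = x₂`
("By lemma 8.2"). [cite: Zhang2022LandauSiegel, §12 p.71; §8 Lemma 8.2, (8.6)] -/
theorem mSum12_eq_lemma82_sums (hℓ : 3 ≤ ell D) (j : ℕ) {d r : ℕ} (hd : 1 ≤ d) (hr : 1 ≤ r) :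
    mSum12 c' χ j d r =
      conj iota3 * (1 / (Real.log (P3 D) : ℂ)) *
          (∑ m ∈ Finset.Ico 1 ⌈P3 D / ((d * r : ℕ) : ℝ)⌉₊,
            χ (m : ZMod D) / (m : ℂ) ^ (1 - betaJ c' D j) *
              ((P3 D / ((d * r : ℕ) : ℝ) / m : ℝ) : ℂ) ^ betaMu D 6 *
                (Real.log (P3 D / ((d * r : ℕ) : ℝ) / m) : ℂ)) +
        conj iota4 * (1 / (Real.log (Skeleton.P2 D) : ℂ)) *
          (∑ m ∈ Finset.Ico 1 ⌈Skeleton.P2 D / ((d * r : ℕ) : ℝ)⌉₊,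
            χ (m : ZMod D) / (m : ℂ) ^ (1 - betaJ c' D j) *
              ((Skeleton.P2 D / ((d * r : ℕ) : ℝ) / m : ℝ) : ℂ) ^ betaMu D 7 *
                (Real.log (Skeleton.P2 D / ((d * r : ℕ) : ℝ) / m) : ℂ)) := by
  obtain ⟨hP3, hP3N, hP2, hP2N⟩ := P3_P2_facts hℓ
  have h3 := sum_rescale82 c' χ j d r hd hr hP3 hP3N (betaMu D 6) (fun k => vk3 D k)
    (fun k hk0 hk => vk3_eq_of_lt hP3 hk0 hk)
    (fun k hk => by simp only [vk3, if_neg (not_lt.mpr hk)])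
  have h2 := sum_rescale82 c' χ j d r hd hr hP2 hP2N (betaMu D 7) (fun k => vk2 D k)
    (fun k hk0 hk => vk2_eq_of_lt hP2 hk0 hk)
    (fun k hk => by simp only [vk2, if_neg (not_lt.mpr hk)])
  rw [mul_assoc (conj iota3), ← h3, mul_assoc (conj iota4), ← h2, mSum12, Finset.mul_sum,
    Finset.mul_sum, ← Finset.sum_add_distrib]
  refine Finset.sum_congr rfl fun m _ => ?_
  ring

/-- **`|𝔣_{jμ}(x)| ≤ F₀(c′) := 1 + (5/2 + 3(1 + 5|c′|π))π`** for `x > 0` with `|log x| ≤ 𝓛⁹`, `𝓛 ≥ 1`: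
`𝔣_{jμ}(x) = (1 + (β_μ − β_j)log x)x^{β_μ}` with `|x^{β_μ}| = 1` (`β_μ ∈ iℝ`), `‖β_μ‖ ≤ 5α/2`,
`‖β_j‖ ≤ 3α(1 + 5|c′|π)`, `α𝓛⁹ = π`. [cite: Zhang2022LandauSiegel, §8 Lemma 8.2] -/
theorem norm_frakfW_le (hD1 : 1 ≤ Real.log D) (j μ : ℕ) {x : ℝ} (hlx : |Real.log x| ≤ ell D ^ 9) :
    ‖frakfW c' D j μ x‖ ≤ 1 + (5 / 2 + 3 * (1 + 5 * |c'| * π)) * π := by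
  have hα := Sec12D.alpha_pos_of_log (D := D) hD1
  have hαL : alpha D * ell D ^ 9 = π := by
    rw [← Skeleton.log_bigP]; exact Sec12D.alpha_mul_logP hD1
  rw [frakfW, frakf, norm_mul]
  have hre : (betaMu D μ).re = 0 := by
    unfold betaMu beta6 beta7; split_ifs <;> simp
  have hexp : ‖cexp (betaMu D μ * (Real.log x : ℂ))‖ = 1 := by
    rw [Complex.norm_exp]
    have : (betaMu D μ * (Real.log x : ℂ)).re = 0 := by simp [hre]
    rw [this, Real.exp_zero]
  rw [hexp, mul_one]
  have hμ : ‖betaMu D μ‖ ≤ 5 / 2 * alpha D := by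
    obtain ⟨h6, h7⟩ := Sec12D.norm_beta67 (D := D) hD1
    unfold betaMu; split_ifs
    · rw [h7]; linarith
    · rw [h6]; linarith
  have hj := Sec12D.norm_betaJ_le c' (D := D) hD1 j
  have hb : ‖betaMu D μ - betaJ c' D j‖ ≤ (5 / 2 + 3 * (1 + 5 * |c'| * π)) * alpha D := by
    calc ‖betaMu D μ - betaJ c' D j‖ ≤ ‖betaMu D μ‖ + ‖betaJ c' D j‖ := norm_sub_le _ _
      _ ≤ 5 / 2 * alpha D + 3 * alpha D * (1 + 5 * |c'| * π) := add_le_add hμ hj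
      _ = (5 / 2 + 3 * (1 + 5 * |c'| * π)) * alpha D := by ring
  have hc : 0 ≤ (5 / 2 + 3 * (1 + 5 * |c'| * π)) := by positivity
  calc ‖1 + (betaMu D μ - betaJ c' D j) * (Real.log x : ℂ)‖
      ≤ ‖(1 : ℂ)‖ + ‖(betaMu D μ - betaJ c' D j) * (Real.log x : ℂ)‖ := norm_add_le _ _
    _ = 1 + ‖betaMu D μ - betaJ c' D j‖ * |Real.log x| := by
        rw [norm_one, norm_mul, Complex.norm_real, Real.norm_eq_abs]
    _ ≤ 1 + (5 / 2 + 3 * (1 + 5 * |c'| * π)) * alpha D * ell D ^ 9 := by gcongr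
    _ = 1 + (5 / 2 + 3 * (1 + 5 * |c'| * π)) * π := by rw [mul_assoc, hαL]

end MSum

/-! ### The size of the `m`-sum on `dr ≤ P″₁` ("By lemma 8.2") -/

section MSumBound

variable (c' : ℝ) {D : ℕ} [NeZero D] (χ : DirichletCharacter ℂ D)

/-- `‖ι₃‖ ≤ 5/4` (`ι₃ = −1.00635 − 0.22789i`, (2.26)). [cite: Zhang2022LandauSiegel, §2 (2.26)] -/
private theorem norm_iota3_le : ‖iota3‖ ≤ 5 / 4 := by
  rw [iota3]
  refine (norm_sub_le _ _).trans ?_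
  rw [norm_mul, Complex.norm_I, mul_one, norm_neg]
  have h1 : ‖(1.00635 : ℂ)‖ = 1.00635 := by
    rw [show (1.00635 : ℂ) = ((1.00635 : ℝ) : ℂ) by norm_num, Complex.norm_real, Real.norm_of_nonneg]
    norm_num
  have h2 : ‖(0.22789 : ℂ)‖ = 0.22789 := by
    rw [show (0.22789 : ℂ) = ((0.22789 : ℝ) : ℂ) by norm_num, Complex.norm_real, Real.norm_of_nonneg]
    norm_num
  rw [h1, h2]
  norm_num

/-- `‖ι₄‖ ≤ 23/10` (`ι₄ = −0.68738 + 1.60688i`, (2.26)). [cite: Zhang2022LandauSiegel, §2 (2.26)] -/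
private theorem norm_iota4_le : ‖iota4‖ ≤ 23 / 10 := by
  rw [iota4]
  refine (norm_add_le _ _).trans ?_
  rw [norm_mul, Complex.norm_I, mul_one, norm_neg]
  have h1 : ‖(0.68738 : ℂ)‖ = 0.68738 := by
    rw [show (0.68738 : ℂ) = ((0.68738 : ℝ) : ℂ) by norm_num, Complex.norm_real, Real.norm_of_nonneg]
    norm_num
  have h2 : ‖(1.60688 : ℂ)‖ = 1.60688 := by
    rw [show (1.60688 : ℂ) = ((1.60688 : ℝ) : ℂ) by norm_num, Complex.norm_real, Real.norm_of_nonneg]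
    norm_num
  rw [h1, h2]
  norm_num

omit [NeZero D] in
/-- From `‖Σ − L′·𝔣‖ ≤ e`, `‖L′‖ ≤ A`, `‖𝔣‖ ≤ G`: `‖Σ‖ ≤ AG + e`. [folklore] -/
private theorem norm_le_of_approx₂ {S L f : ℂ} {e A G : ℝ} (h : ‖S - L * f‖ ≤ e)
    (hL : ‖L‖ ≤ A) (hf : ‖f‖ ≤ G) (hA : 0 ≤ A) : ‖S‖ ≤ A * G + e := by
  have h1 : ‖S‖ ≤ ‖L * f‖ + ‖S - L * f‖ := norm_le_norm_add_norm_sub' S _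
  have h2 : ‖L * f‖ ≤ A * G := by
    rw [norm_mul]
    exact mul_le_mul hL hf (norm_nonneg _) hA
  linarith

omit [NeZero D] in
/-- `‖a·s + b·t‖ ≤ A·S + B·T` from the four norm bounds. [folklore] -/
private theorem norm_add_mul_le {a b s t : ℂ} {A B S T : ℝ} (ha : ‖a‖ ≤ A) (hb : ‖b‖ ≤ B)
    (hs : ‖s‖ ≤ S) (ht : ‖t‖ ≤ T) (hA : 0 ≤ A) (hB : 0 ≤ B) : ‖a * s + b * t‖ ≤ A * S + B * T := by
  refine (norm_add_le _ _).trans ?_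
  refine add_le_add ((norm_mul_le _ _).trans ?_) ((norm_mul_le _ _).trans ?_)
  · exact mul_le_mul ha hs (norm_nonneg _) hA
  · exact mul_le_mul hb ht (norm_nonneg _) hB

/-- **Size of the `m`-sum `Σ_m χ(m)(ῑ₃ϰ₃(drm) + ῑ₄ϰ₂(drm))m^{β_j−1}` on `dr ≤ P″₁`** (`𝓛 ≥ 5`, `χ`
primitive) under the two Lemma 8.2 approximations with constant `C₈₂ ≥ 0` (the hypotheses `h6`, `h7`
are Lemma 8.2 at `μ = 6, x = P₃/(dr)` and `μ = 7, x = P₂/(dr)`, both in its range `T < x < P` by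
`mid_windows`): `‖mSum12‖ ≤ K_M·𝓛⁻⁷`, `K_M = (5/4/0.498 + 23/10/0.4)(4e^{9/2}F₀(c′) + C₈₂)`, using
`‖L′(1,χ)‖ ≤ 4e^{9/2}𝓛²` (`Lemma31.norm_deriv_LFunction_le_near_one`), `|𝔣_{jμ}| ≤ F₀`
(`norm_frakfW_le`), `log P₃ = 0.498𝓛⁹`, `log P₂ ≥ 0.4𝓛⁹`. [cite: Zhang2022LandauSiegel, §12 p.71] -/
theorem norm_mSum12_le (hℓ5 : 5 ≤ ell D) (hp : χ.IsPrimitive) {C82 : ℝ} (hC82 : 0 ≤ C82) (j : ℕ)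
    {d r : ℕ} (hd : 1 ≤ d) (hr : 1 ≤ r) (hdr : ((d * r : ℕ) : ℝ) ≤ P1pp D)
    (h6 : ‖(∑ m ∈ Finset.Ico 1 ⌈P3 D / ((d * r : ℕ) : ℝ)⌉₊,
            χ (m : ZMod D) / (m : ℂ) ^ (1 - betaJ c' D j) *
              ((P3 D / ((d * r : ℕ) : ℝ) / m : ℝ) : ℂ) ^ betaMu D 6 *
                (Real.log (P3 D / ((d * r : ℕ) : ℝ) / m) : ℂ)) -
          deriv χ.LFunction 1 * frakfW c' D j 6 (P3 D / ((d * r : ℕ) : ℝ))‖ ≤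
        C82 * (ell D ^ 6)⁻¹)
    (h7 : ‖(∑ m ∈ Finset.Ico 1 ⌈Skeleton.P2 D / ((d * r : ℕ) : ℝ)⌉₊,
            χ (m : ZMod D) / (m : ℂ) ^ (1 - betaJ c' D j) *
              ((Skeleton.P2 D / ((d * r : ℕ) : ℝ) / m : ℝ) : ℂ) ^ betaMu D 7 *
                (Real.log (Skeleton.P2 D / ((d * r : ℕ) : ℝ) / m) : ℂ)) -
          deriv χ.LFunction 1 * frakfW c' D j 7 (Skeleton.P2 D / ((d * r : ℕ) : ℝ))‖ ≤
        C82 * (ell D ^ 6)⁻¹) :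
    ‖mSum12 c' χ j d r‖ ≤
      (5 / 4 / 0.498 + 23 / 10 / 0.4) *
        (4 * Real.exp (9 / 2) * (1 + (5 / 2 + 3 * (1 + 5 * |c'| * π)) * π) + C82) / ell D ^ 7 := by
  have hℓ3 : 3 ≤ ell D := by linarith
  have h1 : 1 ≤ ell D := by linarith
  have h0 : 0 < ell D := by linarith
  have hD1 : 1 ≤ Real.log D := by rwa [ell] at h1
  have hdr1n : 1 ≤ d * r := Nat.mul_pos hd hr
  obtain ⟨⟨hy3T, hy3P⟩, ⟨hy2T, hy2P⟩⟩ := mid_windows hℓ5 hdr1n (by exact_mod_cast hdr)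
  have hT1 : 1 ≤ bigT D := Sec10C.one_le_bigT D
  set F0 : ℝ := 1 + (5 / 2 + 3 * (1 + 5 * |c'| * π)) * π with hF0
  have hF00 : 0 ≤ F0 := by positivity
  -- ‖L′(1,χ)‖ ≤ 4e^{9/2}𝓛²
  have hLp : ‖deriv χ.LFunction 1‖ ≤ 4 * Real.exp (9 / 2) * ell D ^ 2 := by
    have hq : 3 ≤ Real.log (D : ℕ) := by simpa [ell] using hℓ3
    have h := Lemma31.norm_deriv_LFunction_le_near_one (χ := χ) hq hp (w := 1)
      (by rw [sub_self, norm_zero]; exact div_nonneg zero_le_one (by linarith))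
    rw [← ell] at h
    calc ‖deriv χ.LFunction 1‖ ≤ 2 * Real.exp (9 / 2) * (1 + ell D) * ell D := h
      _ ≤ 2 * Real.exp (9 / 2) * (2 * ell D) * ell D := by gcongr; linarith
      _ = 4 * Real.exp (9 / 2) * ell D ^ 2 := by ring
  -- `|log y| ≤ 𝓛⁹` for the two arguments
  have hlogx : ∀ y : ℝ, bigT D < y → y < bigP D → |Real.log y| ≤ ell D ^ 9 := by
    intro y hy1 hy2
    have hy0 : 1 ≤ y := hT1.trans hy1.le
    rw [abs_of_nonneg (Real.log_nonneg hy0), ← Skeleton.log_bigP]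
    exact Real.log_le_log (by linarith) hy2.le
  have hf6 : ‖frakfW c' D j 6 (P3 D / ((d * r : ℕ) : ℝ))‖ ≤ F0 :=
    norm_frakfW_le c' hD1 j 6 (hlogx _ hy3T hy3P)
  have hf7 : ‖frakfW c' D j 7 (Skeleton.P2 D / ((d * r : ℕ) : ℝ))‖ ≤ F0 :=
    norm_frakfW_le c' hD1 j 7 (hlogx _ hy2T hy2P)
  have hS6 := norm_le_of_approx₂ h6 hLp hf6 (by positivity)
  have hS7 := norm_le_of_approx₂ h7 hLp hf7 (by positivity)
  -- logs of `P₃`, `P₂`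
  have hlog3 : Real.log (P3 D) = 0.498 * ell D ^ 9 := log_P3 D
  have hlog2 : 0.4 * ell D ^ 9 ≤ Real.log (Skeleton.P2 D) := by
    rw [log_P2]
    have h11 := ell_rpow_le_sq h1
    have h7' : (3 : ℝ) ^ 7 ≤ ell D ^ 7 := pow_le_pow_left₀ (by norm_num) hℓ3 7
    nlinarith [pow_nonneg h0.le 2]
  have hl9 : 0 < ell D ^ 9 := by positivity
  have hlog3pos : 0 < Real.log (P3 D) := by rw [hlog3]; positivity
  have hlog2pos : 0 < Real.log (Skeleton.P2 D) := by linarith [hlog2]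
  have hn3 : ‖conj iota3 * (1 / (Real.log (P3 D) : ℂ))‖ ≤ 5 / 4 / (0.498 * ell D ^ 9) := by
    rw [norm_mul, Complex.norm_conj, norm_div, norm_one, Complex.norm_real,
      Real.norm_of_nonneg hlog3pos.le, hlog3, ← div_eq_mul_one_div]
    exact div_le_div_of_nonneg_right norm_iota3_le (by positivity)
  have hn4 : ‖conj iota4 * (1 / (Real.log (Skeleton.P2 D) : ℂ))‖ ≤ 23 / 10 / (0.4 * ell D ^ 9) := by
    rw [norm_mul, Complex.norm_conj, norm_div, norm_one, Complex.norm_real,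
      Real.norm_of_nonneg hlog2pos.le, ← div_eq_mul_one_div]
    exact div_le_div₀ (by norm_num) norm_iota4_le (by positivity) hlog2
  -- common majorant of the two Lemma 8.2 sums
  set B : ℝ := ell D ^ 2 * (4 * Real.exp (9 / 2) * F0 + C82) with hB
  clear h6 h7
  have hC82' : C82 * (ell D ^ 6)⁻¹ ≤ ell D ^ 2 * C82 := by
    have hl6 : (1 : ℝ) ≤ ell D ^ 6 := one_le_pow₀ h1
    have hinv : (ell D ^ 6)⁻¹ ≤ 1 := inv_le_one_of_one_le₀ hl6
    have hℓ2 : (1 : ℝ) ≤ ell D ^ 2 := one_le_pow₀ h1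
    calc C82 * (ell D ^ 6)⁻¹ ≤ C82 * 1 := by gcongr
      _ ≤ ell D ^ 2 * C82 := by rw [mul_one]; exact le_mul_of_one_le_left hC82 hℓ2
  have hSB : ∀ S : ℂ, ‖S‖ ≤ 4 * Real.exp (9 / 2) * ell D ^ 2 * F0 + C82 * (ell D ^ 6)⁻¹ →
      ‖S‖ ≤ B := by
    intro S hS
    rw [hB]
    calc ‖S‖ ≤ 4 * Real.exp (9 / 2) * ell D ^ 2 * F0 + C82 * (ell D ^ 6)⁻¹ := hS
      _ ≤ 4 * Real.exp (9 / 2) * ell D ^ 2 * F0 + ell D ^ 2 * C82 := by gcongr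
      _ = ell D ^ 2 * (4 * Real.exp (9 / 2) * F0 + C82) := by ring
  have hB6 := hSB _ hS6
  have hB7 := hSB _ hS7
  have hBpos : 0 ≤ B := by positivity
  rw [mSum12_eq_lemma82_sums c' χ hℓ3 j hd hr]
  refine (norm_add_mul_le hn3 hn4 hB6 hB7 (by positivity) (by positivity)).trans (le_of_eq ?_)
  rw [hB]
  have h9 : ell D ^ 9 = ell D ^ 7 * ell D ^ 2 := by ring
  rw [h9]
  field_simp

end MSumBound

/-! ### The `n`-sum of `S_j(·,𝐚₂₅)` is `χ(d)χ(r)·sum122` -/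

section NSum

variable (c' : ℝ) {D : ℕ} [NeZero D] (χ : DirichletCharacter ℂ D)

omit [NeZero D] in
/-- **The `n`-sum of `S_j(·,𝐚₂₅)`**: for `𝐚₂₅(k) = conj(χ(k)ϰ₁₃(k))`, real `χ`, `𝓛 ≥ 3` and
`d, r ≥ 1`, `Σ_{n<⌈PT⁻²⌉} 𝐚₂₅(drn)ξ₀ⱼ(n;d,r)/n = χ(d)χ(r)·Σ_{l<⌈P″₂⌉} χ(l)ϰ̄₁₃(drl)ξ₀ⱼ(l;d,r)/l =
χ(d)χ(r)·sum122` (`χ(drn) = χ(d)χ(r)χ(n)`, `χ̄ = χ`; `ϰ₁₃(drl) = 0` once `l ≥ P″₂`, and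
`⌈P″₂⌉ ≤ ⌈PT⁻²⌉`) — the object of (12.11). [cite: Zhang2022LandauSiegel, §12 (12.11)–(12.12) pp.70–71] -/
theorem nSum_a25_eq_sum122 (hD3 : 3 ≤ Real.log D) (hq : χ.IsQuadratic) (a25 : ℕ → ℂ)
    (ha25 : ∀ n, a25 n = conj (χ (n : ZMod D) * vk13 D n)) (j : ℕ) {d r : ℕ} (hd : 1 ≤ d)
    (hr : 1 ≤ r) :
    ∑ n ∈ Finset.Ico 1 (Nsupp D), a25 (d * r * n) * xiZero c' D j n d r / (n : ℂ) =
      χ (d : ZMod D) * χ (r : ZMod D) * sum122 c' χ j d r := by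
  rw [sum122, Finset.mul_sum]
  have hsub : Finset.Ico 1 ⌈P2pp D⌉₊ ⊆ Finset.Ico 1 (Nsupp D) :=
    Finset.Ico_subset_Ico_right (Sec12D.ceil_P2pp_le_Nsupp hD3)
  rw [← Finset.sum_subset hsub]
  · refine Finset.sum_congr rfl fun n _ => ?_
    rw [ha25]
    simp only [Nat.cast_mul, map_mul, conj_eq_self_of_isQuadratic χ hq]
    ring
  · intro n hn hn'
    rw [Finset.mem_Ico] at hn
    have hnP : P2pp D ≤ (n : ℝ) := by
      by_contra h
      exact hn' (Finset.mem_Ico.mpr ⟨hn.1, Nat.lt_ceil.mpr (not_le.mp h)⟩)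
    have hk : P2pp D ≤ ((d * r * n : ℕ) : ℝ) := by
      have : (n : ℝ) ≤ ((d * r * n : ℕ) : ℝ) := by
        exact_mod_cast Nat.le_mul_of_pos_left n (Nat.mul_pos hd hr)
      linarith
    rw [ha25, Sec12D.vk13_eq_zero_of_le hk]
    simp

end NSum

/-! ### Weights, re-indexing by `n = dr`, and the window harmonic sum -/

section Weights

variable (c' : ℝ) {D : ℕ} [NeZero D] (χ : DirichletCharacter ℂ D)

omit [NeZero D] χ in
/-- `|μ(r)| = [r squarefree]` as a complex number. [folklore] -/
private theorem natAbs_moebius_eq (r : ℕ) :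
    (((ArithmeticFunction.moebius r).natAbs : ℕ) : ℂ) = if Squarefree r then 1 else 0 := by
  split_ifs with h
  · rw [ArithmeticFunction.moebius_apply_of_squarefree h]
    simp [Int.natAbs_pow]
  · rw [ArithmeticFunction.moebius_eq_zero_of_not_squarefree h]
    simp

omit [NeZero D] χ in
/-- **The weight of `S_j`**: `‖|μ(r)|λ₀ⱼ(n)/(nφ(r))‖ ≤ [r sqfree]φ(r)⁻¹·(n/φ(n))⁴/n` (`‖λ₀ⱼ(n)‖ ≤ (n/φ(n))⁴`,
`Skeleton.norm_lamZero_le`). [cite: Zhang2022LandauSiegel, §7 Prop. 7.1 p.33] -/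
private theorem norm_weight_le (j : ℕ) {n r : ℕ} (hn : n ≠ 0) (hr : r ≠ 0) :
    ‖(((ArithmeticFunction.moebius r).natAbs : ℕ) : ℂ) * lamZero c' D j n /
        (((n : ℕ) : ℂ) * (Nat.totient r : ℂ))‖ ≤
      (if Squarefree r then 1 / (Nat.totient r : ℝ) else 0) * (((n : ℝ) / Nat.totient n) ^ 4 / n) := by
  have hn0 : (0 : ℝ) < n := by exact_mod_cast Nat.pos_of_ne_zero hn
  have hφr : (0 : ℝ) < Nat.totient r := by exact_mod_cast Nat.totient_pos.mpr (Nat.pos_of_ne_zero hr)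
  have hlam := norm_lamZero_le c' D j hn
  rw [natAbs_moebius_eq, norm_div, norm_mul, norm_mul, Complex.norm_natCast, Complex.norm_natCast]
  split_ifs with hsq
  · rw [norm_one, one_mul]
    calc ‖lamZero c' D j n‖ / ((n : ℝ) * Nat.totient r)
        ≤ ((n : ℝ) / Nat.totient n) ^ 4 / ((n : ℝ) * Nat.totient r) :=
          div_le_div_of_nonneg_right hlam (by positivity)
      _ = 1 / (Nat.totient r : ℝ) * (((n : ℝ) / Nat.totient n) ^ 4 / n) := by
          field_simp
  · simp

omit [NeZero D] in
open scoped Classical in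
/-- **The substitution `n = dr`** for the middle range: `S_j(𝐚₁₂,𝐚₂₅)|_{P″₁/T<dr≤P″₁} =
Σ_{n: P″₁/T<n≤P″₁} Σ_{r∣n} (term at `d = n/r`)` (`n ≤ P″₁ < P″₂ ≤ PT⁻²`, so the box truncation is
vacuous; `Skeleton.sum_box_ite_eq_sum_divisors`). [cite: Zhang2022LandauSiegel, §12 p.71] -/
private theorem SjOn_mid_eq (hℓ5 : 5 ≤ ell D) (j : ℕ) (a25 : ℕ → ℂ) :
    SjOn c' D j (a12 χ) a25 (rngMid D) =
      ∑ n ∈ (Finset.Ico 1 (Nsupp D)).filter (rngMid D), ∑ r ∈ n.divisors,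
        ((((ArithmeticFunction.moebius r).natAbs : ℕ) : ℂ) * lamZero c' D j (n / r * r) /
            (((n / r * r : ℕ) : ℂ) * (Nat.totient r : ℂ)) *
          (∑ m ∈ Finset.Ico 1 (Nsupp D), a12 χ (n / r * r * m) / (m : ℂ) ^ (1 - betaJ c' D j)) *
          (∑ m ∈ Finset.Ico 1 (Nsupp D),
            a25 (n / r * r * m) * xiZero c' D j m (n / r) r / (m : ℂ))) := by
  have hℓ3 : 3 ≤ ell D := by linarith
  have hD3 : 3 ≤ Real.log D := by rwa [ell] at hℓ3
  obtain ⟨-, -, -, h12⟩ := P1pp_facts hℓ5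
  have hP2N := Sec12D.P2pp_le_P_div_T_sq (D := D) hD3
  have hp : ∀ n : ℕ, rngMid D n → n < Nsupp D := by
    intro n hn
    rw [Nsupp]
    exact Nat.lt_ceil.mpr ((hn.2.trans_lt h12).trans_le hP2N)
  unfold SjOn
  exact sum_box_ite_eq_sum_divisors (Nsupp D) (rngMid D) hp _

omit [NeZero D] χ in
/-- **The window harmonic sum of the middle range**: for any finite set of `n` with
`P″₁/T < n ≤ P″₁` (`𝓛 ≥ 5`), `Σ (n/φ(n))⁹/n ≤ e^{1024}(3 + 𝓛²)` — logarithmic length `log T = 𝓛^{1.1} ≤ 𝓛²`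
(`Skeleton.sum_ratio_pow_div_le 9`). [cite: Zhang2022LandauSiegel, §12 p.71] -/
private theorem sum_mid_weights_le (hℓ5 : 5 ≤ ell D) (F : Finset ℕ)
    (hF : ∀ n ∈ F, P1pp D / bigT D < (n : ℝ) ∧ (n : ℝ) ≤ P1pp D) :
    ∑ n ∈ F, ((n : ℝ) / Nat.totient n) ^ 9 / n ≤ Real.exp 1024 * (3 + ell D ^ 2) := by
  have h1 : 1 ≤ ell D := by linarith
  have hD1 : 1 ≤ Real.log D := by rwa [ell] at h1
  obtain ⟨hTP, -, -, -⟩ := P1pp_facts hℓ5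
  have hT0 : 0 < bigT D := Real.exp_pos _
  have hT1 : 1 ≤ bigT D := Sec10C.one_le_bigT D
  have hP1pp : 0 < P1pp D := Sec12D.P1pp_pos hD1
  set a : ℝ := P1pp D / bigT D with ha
  have ha1 : 1 ≤ a := by rw [ha, le_div_iff₀ hT0, one_mul]; exact hTP
  have haP : a ≤ P1pp D := div_le_self hP1pp.le hT1
  set Y : ℕ := ⌊a⌋₊ with hY
  set X : ℕ := ⌊P1pp D⌋₊ with hX
  have hY1 : 1 ≤ Y := Nat.le_floor (by exact_mod_cast ha1)
  have hY0 : 0 < Y := hY1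
  have hYX : Y ≤ X := Nat.floor_le_floor haP
  have hsub : F ⊆ Finset.Ioc Y X := by
    intro n hn
    obtain ⟨hlo, hhi⟩ := hF n hn
    rw [Finset.mem_Ioc]
    exact ⟨(Nat.floor_lt (by linarith)).mpr hlo, Nat.le_floor hhi⟩
  have hlog2 := Real.log_two_lt_d9
  -- `log X ≤ log P″₁`, `log Y ≥ log a − log 2`
  have hXle : Real.log (X : ℕ) ≤ Real.log (P1pp D) := by
    have hX0 : (0 : ℝ) < X := by exact_mod_cast lt_of_lt_of_le hY0 hYX
    exact Real.log_le_log hX0 (Nat.floor_le hP1pp.le)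
  have hYge : Real.log a - Real.log 2 ≤ Real.log (Y : ℕ) := by
    have hf : a / 2 ≤ (Y : ℝ) := by
      rcases le_or_gt 2 a with h2 | h2
      · have := Nat.lt_floor_add_one a
        rw [← hY] at this
        linarith
      · have : (1 : ℝ) ≤ Y := by exact_mod_cast hY1
        linarith
    rw [← Real.log_div (by linarith) (by norm_num)]
    exact Real.log_le_log (by linarith) hf
  have hloga : Real.log a = Real.log (P1pp D) - ell D ^ (1.1 : ℝ) := by
    rw [ha, Real.log_div hP1pp.ne' hT0.ne', log_bigT']
  have h11 := ell_rpow_le_sq h1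
  calc ∑ n ∈ F, ((n : ℝ) / Nat.totient n) ^ 9 / n
      ≤ ∑ n ∈ Finset.Ioc Y X, ((n : ℝ) / Nat.totient n) ^ 9 / n :=
        Finset.sum_le_sum_of_subset_of_nonneg hsub fun n _ _ => by positivity
    _ ≤ Real.exp (2 ^ (9 + 1)) * (1 + Real.log X - Real.log Y) := sum_ratio_pow_div_le 9 hY0 hYX
    _ = Real.exp 1024 * (1 + Real.log X - Real.log Y) := by norm_num
    _ ≤ Real.exp 1024 * (3 + ell D ^ 2) := by
        gcongr
        linarith

omit [NeZero D] χ in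
/-- The closing arithmetic: `K(3 + 𝓛²)𝓛⁻¹² ≤ επ𝓛⁻⁹` once `𝓛 ≥ max(1, 4K/(επ))`. [folklore] -/
private theorem closing_bound {K ε L : ℝ} (hK : 0 ≤ K) (hε : 0 < ε) (hL1 : 1 ≤ L)
    (hL : 4 * K / (ε * π) ≤ L) : K * (3 + L ^ 2) / L ^ 12 ≤ ε * π / L ^ 9 := by
  have hπ := Real.pi_pos
  have hL0 : 0 < L := by linarith
  have h1 : 4 * K ≤ ε * π * L := by
    have := (div_le_iff₀ (by positivity : 0 < ε * π)).mp hL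
    linarith
  rw [div_le_div_iff₀ (by positivity) (by positivity)]
  have h2 : 3 + L ^ 2 ≤ 4 * L ^ 2 := by nlinarith
  have h3 : K * (3 + L ^ 2) ≤ ε * π * L ^ 3 := by
    calc K * (3 + L ^ 2) ≤ K * (4 * L ^ 2) := by gcongr
      _ = 4 * K * L ^ 2 := by ring
      _ ≤ ε * π * L * L ^ 2 := by gcongr
      _ = ε * π * L ^ 3 := by ring
  calc K * (3 + L ^ 2) * L ^ 9 ≤ ε * π * L ^ 3 * L ^ 9 := by gcongr
    _ = ε * π * L ^ 12 := by ring

end Weights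

/-! ### The edge `(12.11) ∧ Lemma 8.2 ⇒ Mid1225` -/

section Edge

variable (c' : ℝ)

/-- **Z22 p.71 (tex L3605), "the sum over `P″₁/T < dr ≤ P″₁` contributes `o(α)`", as an EDGE THEOREM
from a WEAK form of (12.11)** (for the manuscript's parameter range `c′ ≥ 0`): if, under (A) and for
`D` large, the `n`-sum `Σ_l χ(l)ϰ̄₁₃(drl)ξ₀ⱼ(l;d,r)/l` (`Typed.Sec12B.sum122`) satisfies
`‖·‖ ≤ C·𝓛⁻⁵·(dr/φ(dr))⁴` on `P″₁/T < dr ≤ P″₁` — implied by the typed (12.11) `Typed.Sec12B.Eq1211`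
(`≤ C·α·𝓛 = Cπ𝓛⁻⁸`), by its `α₁ = α𝓛^{1.1}` reading, and by the relative (Lemma 8.4-type) readings with
a factor `(∏_{q∣dr}(1 − q⁻¹)⁻¹)^k`, `k ≤ 4` — then `Typed.Sec12C.Mid1225 c′` holds: Lemma 8.2
(`Skeleton.lemma82_holds`) bounds the `m`-sum by `K_M𝓛⁻⁷` (`norm_mSum12_le`), the weights sum to
`≤ e^{1024}(3 + 𝓛²)` (`sum_mid_weights_le`), total `≤ 4K_M C e^{1024}𝓛^{−10} ≤ εα = επ𝓛⁻⁹` for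
`𝓛 ≥ 4K_M C e^{1024}/(επ)`. [cite: Zhang2022LandauSiegel, §12 (12.12) p.71, tex L3605] -/
theorem mid1225_of_eq1211_weak (hc' : 0 ≤ c')
    (h1211 : ∃ C : ℝ, ForAllLarge fun D _ χ => AssumptionA D χ →
      ∀ j ∈ ({1, 2, 3} : Finset ℕ), ∀ d r : ℕ, 1 ≤ d → 1 ≤ r →
        P1pp D / bigT D < ((d * r : ℕ) : ℝ) → ((d * r : ℕ) : ℝ) ≤ P1pp D →
          ‖sum122 c' χ j d r‖ ≤
            C * (ell D ^ 5)⁻¹ * ((((d * r : ℕ) : ℝ)) / Nat.totient (d * r)) ^ 4) :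
    Mid1225 c' := by
  classical
  intro ε hε
  obtain ⟨C82, D82, H82⟩ := lemma82_holds hc'
  obtain ⟨CN, DN, HN⟩ := h1211
  -- constants
  obtain ⟨F0, hF0⟩ : ∃ F0 : ℝ, F0 = 1 + (5 / 2 + 3 * (1 + 5 * |c'| * π)) * π := ⟨_, rfl⟩
  have hF00 : 0 ≤ F0 := by rw [hF0]; positivity
  obtain ⟨C82', hC82'⟩ : ∃ C82' : ℝ, C82' = max C82 0 := ⟨_, rfl⟩
  have hC82'0 : 0 ≤ C82' := by rw [hC82']; exact le_max_right _ _
  have hC82le : C82 ≤ C82' := by rw [hC82']; exact le_max_left _ _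
  obtain ⟨CN', hCN'⟩ : ∃ CN' : ℝ, CN' = max CN 0 := ⟨_, rfl⟩
  have hCN'0 : 0 ≤ CN' := by rw [hCN']; exact le_max_right _ _
  have hCNle : CN ≤ CN' := by rw [hCN']; exact le_max_left _ _
  obtain ⟨KM, hKM⟩ : ∃ KM : ℝ,
      KM = (5 / 4 / 0.498 + 23 / 10 / 0.4) * (4 * Real.exp (9 / 2) * F0 + C82') := ⟨_, rfl⟩
  have hKM0 : 0 ≤ KM := by rw [hKM]; positivity
  obtain ⟨L1, hL1⟩ : ∃ L1 : ℝ, L1 = 4 * (KM * CN' * Real.exp 1024) / (ε * π) := ⟨_, rfl⟩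
  obtain ⟨L0, hL0⟩ : ∃ L0 : ℝ, L0 = max 5 L1 := ⟨_, rfl⟩
  refine ⟨max (max D82 DN) ⌈Real.exp L0⌉₊, fun D _ χ hD hq hp hA a25 ha25 j hj => ?_⟩
  have hD82 : D82 ≤ D := (le_max_left _ _).trans ((le_max_left _ _).trans hD)
  have hDN : DN ≤ D := (le_max_right _ _).trans ((le_max_left _ _).trans hD)
  have hℓL0 : L0 ≤ ell D := le_ell_of_ceil_exp_le (le_of_max_le_right hD)
  have hℓ5 : 5 ≤ ell D := by rw [hL0] at hℓL0; exact (le_max_left _ _).trans hℓL0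
  have hℓL1 : L1 ≤ ell D := by rw [hL0] at hℓL0; exact (le_max_right _ _).trans hℓL0
  have hℓ3 : 3 ≤ ell D := by linarith
  have h1 : 1 ≤ ell D := by linarith
  have h0 : 0 < ell D := by linarith
  have hD3 : 3 ≤ Real.log D := by rwa [ell] at hℓ3
  have H82D := H82 D χ hD82 hq hp hA j hj
  have HND := HN D χ hDN hq hp hA j hj
  -- the `m`-sum per `(n/r, r)`
  have hM : ∀ n : ℕ, 1 ≤ n → (n : ℝ) ≤ P1pp D → ∀ r ∈ n.divisors,
      ‖∑ m ∈ Finset.Ico 1 (Nsupp D), a12 χ (n / r * r * m) / (m : ℂ) ^ (1 - betaJ c' D j)‖ ≤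
        KM / ell D ^ 7 := by
    intro n hn hnP r hr
    have hrn : r ∣ n := Nat.dvd_of_mem_divisors hr
    have hr1 : 1 ≤ r := Nat.pos_of_mem_divisors hr
    have hdr : n / r * r = n := Nat.div_mul_cancel hrn
    have hd1 : 1 ≤ n / r := Nat.div_pos (Nat.le_of_dvd hn hrn) hr1
    have hdrR : ((n / r * r : ℕ) : ℝ) = n := by rw [hdr]
    have hdrP : ((n / r * r : ℕ) : ℝ) ≤ P1pp D := by rw [hdrR]; exact hnP
    obtain ⟨⟨hy3T, hy3P⟩, ⟨hy2T, hy2P⟩⟩ := mid_windows hℓ5 hn hnP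
    rw [← hdrR] at hy3T hy3P hy2T hy2P
    have h6 := (H82D 6 (by simp) _ hy3T hy3P).trans
      (mul_le_mul_of_nonneg_right hC82le (by positivity))
    have h7 := (H82D 7 (by simp) _ hy2T hy2P).trans
      (mul_le_mul_of_nonneg_right hC82le (by positivity))
    have key := norm_mSum12_le c' χ hℓ5 hp hC82'0 j hd1 hr1 hdrP h6 h7
    rw [← hF0, ← hKM] at key
    rw [mSum_a12_eq]
    calc ‖χ ((n / r : ℕ) : ZMod D) * χ (r : ZMod D) * mSum12 c' χ j (n / r) r‖
        ≤ 1 * 1 * (KM / ell D ^ 7) := by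
          rw [norm_mul, norm_mul]
          gcongr
          · exact χ.norm_le_one _
          · exact χ.norm_le_one _
      _ = KM / ell D ^ 7 := by ring
  -- the `n`-sum per `(n/r, r)`, from (12.11)
  have hN : ∀ n : ℕ, 1 ≤ n → P1pp D / bigT D < (n : ℝ) → (n : ℝ) ≤ P1pp D → ∀ r ∈ n.divisors,
      ‖∑ m ∈ Finset.Ico 1 (Nsupp D), a25 (n / r * r * m) * xiZero c' D j m (n / r) r / (m : ℂ)‖ ≤
        CN' * (ell D ^ 5)⁻¹ * (((n : ℝ) / Nat.totient n) ^ 4) := by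
    intro n hn hnlo hnP r hr
    have hrn : r ∣ n := Nat.dvd_of_mem_divisors hr
    have hr1 : 1 ≤ r := Nat.pos_of_mem_divisors hr
    have hdr : n / r * r = n := Nat.div_mul_cancel hrn
    have hd1 : 1 ≤ n / r := Nat.div_pos (Nat.le_of_dvd hn hrn) hr1
    have hdrR : ((n / r * r : ℕ) : ℝ) = n := by rw [hdr]
    have key := HND (n / r) r hd1 hr1 (by rw [hdrR]; exact hnlo) (by rw [hdrR]; exact hnP)
    rw [hdr] at key
    rw [nSum_a25_eq_sum122 c' χ hD3 hq a25 ha25 j hd1 hr1]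
    calc ‖χ ((n / r : ℕ) : ZMod D) * χ (r : ZMod D) * sum122 c' χ j (n / r) r‖
        ≤ 1 * 1 * (CN * (ell D ^ 5)⁻¹ * (((n : ℝ) / Nat.totient n) ^ 4)) := by
          rw [norm_mul, norm_mul]
          refine mul_le_mul (mul_le_mul (χ.norm_le_one _) (χ.norm_le_one _) (norm_nonneg _)
            zero_le_one) key (norm_nonneg _) (by norm_num)
      _ ≤ 1 * 1 * (CN' * (ell D ^ 5)⁻¹ * (((n : ℝ) / Nat.totient n) ^ 4)) := by gcongr
      _ = CN' * (ell D ^ 5)⁻¹ * (((n : ℝ) / Nat.totient n) ^ 4) := by ring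
  -- assemble
  rw [SjOn_mid_eq c' χ hℓ5 j a25]
  set F : Finset ℕ := (Finset.Ico 1 (Nsupp D)).filter (rngMid D) with hF
  have hFmem : ∀ n ∈ F, 1 ≤ n ∧ P1pp D / bigT D < (n : ℝ) ∧ (n : ℝ) ≤ P1pp D := by
    intro n hn
    rw [hF, Finset.mem_filter, Finset.mem_Ico] at hn
    exact ⟨hn.1.1, hn.2.1, hn.2.2⟩
  have hper : ∀ n ∈ F, ∑ r ∈ n.divisors,
      ‖(((ArithmeticFunction.moebius r).natAbs : ℕ) : ℂ) * lamZero c' D j (n / r * r) /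
            (((n / r * r : ℕ) : ℂ) * (Nat.totient r : ℂ)) *
          (∑ m ∈ Finset.Ico 1 (Nsupp D), a12 χ (n / r * r * m) / (m : ℂ) ^ (1 - betaJ c' D j)) *
          (∑ m ∈ Finset.Ico 1 (Nsupp D),
            a25 (n / r * r * m) * xiZero c' D j m (n / r) r / (m : ℂ))‖ ≤
      ((n : ℝ) / Nat.totient n) ^ 9 / n * (KM / ell D ^ 7) * (CN' * (ell D ^ 5)⁻¹) := by
    intro n hn
    obtain ⟨hn1, hnlo, hnP⟩ := hFmem n hn
    have hn0 : n ≠ 0 := by omega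
    have hρ : 0 ≤ (n : ℝ) / Nat.totient n := by positivity
    calc ∑ r ∈ n.divisors,
          ‖(((ArithmeticFunction.moebius r).natAbs : ℕ) : ℂ) * lamZero c' D j (n / r * r) /
                (((n / r * r : ℕ) : ℂ) * (Nat.totient r : ℂ)) *
              (∑ m ∈ Finset.Ico 1 (Nsupp D), a12 χ (n / r * r * m) / (m : ℂ) ^ (1 - betaJ c' D j)) *
              (∑ m ∈ Finset.Ico 1 (Nsupp D),
                a25 (n / r * r * m) * xiZero c' D j m (n / r) r / (m : ℂ))‖
        ≤ ∑ r ∈ n.divisors, (if Squarefree r then 1 / (Nat.totient r : ℝ) else 0) *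
            (((n : ℝ) / Nat.totient n) ^ 4 / n) * (KM / ell D ^ 7) *
            (CN' * (ell D ^ 5)⁻¹ * (((n : ℝ) / Nat.totient n) ^ 4)) := by
          refine Finset.sum_le_sum fun r hr => ?_
          have hrn : r ∣ n := Nat.dvd_of_mem_divisors hr
          have hr0 : r ≠ 0 := (Nat.pos_of_mem_divisors hr).ne'
          have hdr : n / r * r = n := Nat.div_mul_cancel hrn
          have hw := norm_weight_le c' (D := D) j hn0 hr0
          have hw' : ‖(((ArithmeticFunction.moebius r).natAbs : ℕ) : ℂ) * lamZero c' D j (n / r * r) /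
              (((n / r * r : ℕ) : ℂ) * (Nat.totient r : ℂ))‖ ≤
              (if Squarefree r then 1 / (Nat.totient r : ℝ) else 0) *
                (((n : ℝ) / Nat.totient n) ^ 4 / n) := by
            rw [hdr]; exact hw
          rw [norm_mul, norm_mul]
          have hMv : 0 ≤ KM / ell D ^ 7 := by positivity
          have hMn := hM n hn1 hnP r hr
          have hNn := hN n hn1 hnlo hnP r hr
          gcongr
      _ = (∑ r ∈ n.divisors with Squarefree r, (1 / (Nat.totient r : ℝ))) *
            ((((n : ℝ) / Nat.totient n) ^ 4 / n) * (KM / ell D ^ 7) *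
              (CN' * (ell D ^ 5)⁻¹ * (((n : ℝ) / Nat.totient n) ^ 4))) := by
          rw [Finset.sum_filter, Finset.sum_mul]
          refine Finset.sum_congr rfl fun r _ => ?_
          split_ifs <;> ring
      _ = ((n : ℝ) / Nat.totient n) ^ 9 / n * (KM / ell D ^ 7) * (CN' * (ell D ^ 5)⁻¹) := by
          rw [sum_sqfree_divisors_inv_totient hn0]
          ring
  have hweights := sum_mid_weights_le (D := D) hℓ5 F (fun n hn => (hFmem n hn).2)
  have hαeq : alpha D = π / ell D ^ 9 := Section2.alpha_eq_pi_div_ell9 D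
  have hfin := closing_bound (K := KM * CN' * Real.exp 1024) (by positivity) hε h1
    (by rw [hL1] at hℓL1; exact hℓL1)
  calc ‖∑ n ∈ F, ∑ r ∈ n.divisors,
          (((ArithmeticFunction.moebius r).natAbs : ℕ) : ℂ) * lamZero c' D j (n / r * r) /
              (((n / r * r : ℕ) : ℂ) * (Nat.totient r : ℂ)) *
            (∑ m ∈ Finset.Ico 1 (Nsupp D), a12 χ (n / r * r * m) / (m : ℂ) ^ (1 - betaJ c' D j)) *
            (∑ m ∈ Finset.Ico 1 (Nsupp D),
              a25 (n / r * r * m) * xiZero c' D j m (n / r) r / (m : ℂ))‖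
      ≤ ∑ n ∈ F, ‖∑ r ∈ n.divisors,
          (((ArithmeticFunction.moebius r).natAbs : ℕ) : ℂ) * lamZero c' D j (n / r * r) /
              (((n / r * r : ℕ) : ℂ) * (Nat.totient r : ℂ)) *
            (∑ m ∈ Finset.Ico 1 (Nsupp D), a12 χ (n / r * r * m) / (m : ℂ) ^ (1 - betaJ c' D j)) *
            (∑ m ∈ Finset.Ico 1 (Nsupp D),
              a25 (n / r * r * m) * xiZero c' D j m (n / r) r / (m : ℂ))‖ := norm_sum_le _ _
    _ ≤ ∑ n ∈ F, ∑ r ∈ n.divisors,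
          ‖(((ArithmeticFunction.moebius r).natAbs : ℕ) : ℂ) * lamZero c' D j (n / r * r) /
              (((n / r * r : ℕ) : ℂ) * (Nat.totient r : ℂ)) *
            (∑ m ∈ Finset.Ico 1 (Nsupp D), a12 χ (n / r * r * m) / (m : ℂ) ^ (1 - betaJ c' D j)) *
            (∑ m ∈ Finset.Ico 1 (Nsupp D),
              a25 (n / r * r * m) * xiZero c' D j m (n / r) r / (m : ℂ))‖ :=
        Finset.sum_le_sum fun n _ => norm_sum_le _ _
    _ ≤ ∑ n ∈ F, ((n : ℝ) / Nat.totient n) ^ 9 / n * (KM / ell D ^ 7) * (CN' * (ell D ^ 5)⁻¹) :=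
        Finset.sum_le_sum hper
    _ = (KM / ell D ^ 7) * (CN' * (ell D ^ 5)⁻¹) * ∑ n ∈ F, ((n : ℝ) / Nat.totient n) ^ 9 / n := by
        rw [Finset.mul_sum]
        refine Finset.sum_congr rfl fun n _ => ?_
        ring
    _ ≤ (KM / ell D ^ 7) * (CN' * (ell D ^ 5)⁻¹) * (Real.exp 1024 * (3 + ell D ^ 2)) := by
        gcongr
    _ = KM * CN' * Real.exp 1024 * (3 + ell D ^ 2) / ell D ^ 12 := by
        field_simp
    _ ≤ ε * π / ell D ^ 9 := hfin
    _ = ε * alpha D := by rw [hαeq]; ring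

/-- **`Typed.Sec12C.Mid1225` from the typed (12.11) and Lemma 8.2** — the printed sentence "By lemma
8.2, 8.3 and 12.1 [12.2], the sum over `P″₁/T < dr ≤ P″₁` contributes `o(α)`" (p.71, tex L3605) HOLDS
as a deduction, for every `c′ ≥ 0`: `Typed.Sec12B.Eq1211 c′ → Mid1225 c′` (Lemma 8.2 is the tree's
`Skeleton.lemma82_holds`; Lemma 8.3 enters only through the proof of (12.11), which is NOT given in
print — GAP row G-L3t5-2 — and is not claimed here). The hypothesis `hMid` of
`Skeleton.theorem1_of_leaves_v19` thereby reduces to (12.11). [cite: Zhang2022LandauSiegel, §12 (12.12) p.71, tex L3605; Lemma 12.2 (12.11) p.70] -/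
theorem mid1225_of_eq1211 (hc' : 0 ≤ c') (h1211 : Eq1211 c') : Mid1225 c' := by
  refine mid1225_of_eq1211_weak c' hc' ?_
  obtain ⟨C, D₀, h⟩ := h1211
  refine ⟨|C| * π, max D₀ ⌈Real.exp 1⌉₊, fun D _ χ hD hq hp hA j hj d r hd hr hlo hhi => ?_⟩
  have hD₀ : D₀ ≤ D := (le_max_left _ _).trans hD
  have h1 : 1 ≤ ell D := le_ell_of_ceil_exp_le (le_of_max_le_right hD)
  have hD1 : 1 ≤ Real.log D := by rwa [ell] at h1
  have key := h D χ hD₀ hq hp hA j hj d r hd hr hlo.le hhi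
  have hα := Sec12D.alpha_pos_of_log (D := D) hD1
  have hαℓ : alpha D * ell D = π * (ell D ^ 8)⁻¹ := Sec12D.alpha_mul_ell_eq hD1
  have hρ1 : 1 ≤ ((((d * r : ℕ) : ℝ)) / Nat.totient (d * r)) :=
    one_le_self_div_totient (Nat.mul_pos hd hr).ne'
  have hρ4 : 1 ≤ ((((d * r : ℕ) : ℝ)) / Nat.totient (d * r)) ^ 4 := one_le_pow₀ hρ1
  have hℓ0 : 0 < ell D := by linarith
  have h58 : (ell D ^ 8)⁻¹ ≤ (ell D ^ 5)⁻¹ :=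
    inv_anti₀ (pow_pos hℓ0 5) (pow_le_pow_right₀ h1 (by norm_num))
  calc ‖sum122 c' χ j d r‖ ≤ C * alpha D * ell D := key
    _ ≤ |C| * alpha D * ell D := by
        have : C * (alpha D * ell D) ≤ |C| * (alpha D * ell D) :=
          mul_le_mul_of_nonneg_right (le_abs_self C) (by positivity)
        linarith [this]
    _ = |C| * π * (ell D ^ 8)⁻¹ := by rw [mul_assoc, hαℓ, ← mul_assoc]
    _ ≤ |C| * π * (ell D ^ 5)⁻¹ := mul_le_mul_of_nonneg_left h58 (by positivity)
    _ = |C| * π * (ell D ^ 5)⁻¹ * 1 := (mul_one _).symm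
    _ ≤ |C| * π * (ell D ^ 5)⁻¹ * ((((d * r : ℕ) : ℝ)) / Nat.totient (d * r)) ^ 4 := by gcongr

end Edge

/-! ### The edge with the sharpest budget: any `n`-sum bound `C·𝓛^{−a}·(dr/φ(dr))⁴` with `a > 3.1` -/

section EdgeRpow

variable (c' : ℝ)

/-- **The window harmonic sum of the middle range, exact logarithmic length**: for any finite set of
`n` with `P″₁/T < n ≤ P″₁` (`𝓛 ≥ 5`), `Σ (n/φ(n))⁹/n ≤ e^{1024}(3 + 𝓛^{1.1})` (`log T = 𝓛^{1.1}`;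
`Skeleton.sum_ratio_pow_div_le 9`). [cite: Zhang2022LandauSiegel, §12 p.71] -/
private theorem sum_mid_weights_le' {D : ℕ} (hℓ5 : 5 ≤ ell D) (F : Finset ℕ)
    (hF : ∀ n ∈ F, P1pp D / bigT D < (n : ℝ) ∧ (n : ℝ) ≤ P1pp D) :
    ∑ n ∈ F, ((n : ℝ) / Nat.totient n) ^ 9 / n ≤ Real.exp 1024 * (3 + ell D ^ (1.1 : ℝ)) := by
  have h1 : 1 ≤ ell D := by linarith
  have hD1 : 1 ≤ Real.log D := by rwa [ell] at h1
  obtain ⟨hTP, -, -, -⟩ := P1pp_facts hℓ5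
  have hT0 : 0 < bigT D := Real.exp_pos _
  have hT1 : 1 ≤ bigT D := Sec10C.one_le_bigT D
  have hP1pp : 0 < P1pp D := Sec12D.P1pp_pos hD1
  set a : ℝ := P1pp D / bigT D with ha
  have ha1 : 1 ≤ a := by rw [ha, le_div_iff₀ hT0, one_mul]; exact hTP
  have haP : a ≤ P1pp D := div_le_self hP1pp.le hT1
  set Y : ℕ := ⌊a⌋₊ with hY
  set X : ℕ := ⌊P1pp D⌋₊ with hX
  have hY1 : 1 ≤ Y := Nat.le_floor (by exact_mod_cast ha1)
  have hY0 : 0 < Y := hY1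
  have hYX : Y ≤ X := Nat.floor_le_floor haP
  have hsub : F ⊆ Finset.Ioc Y X := by
    intro n hn
    obtain ⟨hlo, hhi⟩ := hF n hn
    rw [Finset.mem_Ioc]
    exact ⟨(Nat.floor_lt (by linarith)).mpr hlo, Nat.le_floor hhi⟩
  have hlog2 := Real.log_two_lt_d9
  have hXle : Real.log (X : ℕ) ≤ Real.log (P1pp D) := by
    have hX0 : (0 : ℝ) < X := by exact_mod_cast lt_of_lt_of_le hY0 hYX
    exact Real.log_le_log hX0 (Nat.floor_le hP1pp.le)
  have hYge : Real.log a - Real.log 2 ≤ Real.log (Y : ℕ) := by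
    have hf : a / 2 ≤ (Y : ℝ) := by
      rcases le_or_gt 2 a with h2 | h2
      · have := Nat.lt_floor_add_one a
        rw [← hY] at this
        linarith
      · have : (1 : ℝ) ≤ Y := by exact_mod_cast hY1
        linarith
    rw [← Real.log_div (by linarith) (by norm_num)]
    exact Real.log_le_log (by linarith) hf
  have hloga : Real.log a = Real.log (P1pp D) - ell D ^ (1.1 : ℝ) := by
    rw [ha, Real.log_div hP1pp.ne' hT0.ne', log_bigT']
  calc ∑ n ∈ F, ((n : ℝ) / Nat.totient n) ^ 9 / n
      ≤ ∑ n ∈ Finset.Ioc Y X, ((n : ℝ) / Nat.totient n) ^ 9 / n :=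
        Finset.sum_le_sum_of_subset_of_nonneg hsub fun n _ _ => by positivity
    _ ≤ Real.exp (2 ^ (9 + 1)) * (1 + Real.log X - Real.log Y) := sum_ratio_pow_div_le 9 hY0 hYX
    _ = Real.exp 1024 * (1 + Real.log X - Real.log Y) := by norm_num
    _ ≤ Real.exp 1024 * (3 + ell D ^ (1.1 : ℝ)) := by
        gcongr
        linarith

/-- The closing arithmetic with a real exponent: for `a > 3.1`, `L ≥ 1` and
`L ≥ (4K/(επ))^{1/(a − 3.1)}`, `K(3 + L^{1.1})L^{−a}/L⁷ ≤ επ/L⁹` (`3 + L^{1.1} ≤ 4L^{1.1}`,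
`L^{−a} = L^{−(a−3.1)}·L^{−1.1}·L^{−2}`). [folklore] -/
private theorem closing_bound_rpow {K ε L a : ℝ} (hK : 0 ≤ K) (hε : 0 < ε) (hL1 : 1 ≤ L)
    (ha : 3.1 < a) (hL : (4 * K / (ε * π)) ^ (1 / (a - 3.1)) ≤ L) :
    K * (3 + L ^ (1.1 : ℝ)) * L ^ (-a) / L ^ 7 ≤ ε * π / L ^ 9 := by
  have hπ := Real.pi_pos
  have hL0 : 0 < L := by linarith
  have ht : 0 < a - 3.1 := by linarith
  have hq0 : 0 ≤ 4 * K / (ε * π) := by positivity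
  -- `επ·L^{a−3.1} ≥ 4K`
  have h4K : 4 * K ≤ ε * π * L ^ (a - 3.1) := by
    have h1 : (4 * K / (ε * π)) ^ (1 / (a - 3.1)) ≥ 0 := Real.rpow_nonneg hq0 _
    have h2 : ((4 * K / (ε * π)) ^ (1 / (a - 3.1))) ^ (a - 3.1) ≤ L ^ (a - 3.1) :=
      Real.rpow_le_rpow h1 hL ht.le
    have h3 : ((4 * K / (ε * π)) ^ (1 / (a - 3.1))) ^ (a - 3.1) = 4 * K / (ε * π) := by
      rw [← Real.rpow_mul hq0, one_div_mul_cancel ht.ne', Real.rpow_one]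
    rw [h3, div_le_iff₀ (by positivity)] at h2
    linarith
  -- `3 + L^{1.1} ≤ 4L^{1.1}`
  have h11 : 1 ≤ L ^ (1.1 : ℝ) := Real.one_le_rpow hL1 (by norm_num)
  have h31 : 3 + L ^ (1.1 : ℝ) ≤ 4 * L ^ (1.1 : ℝ) := by linarith
  -- split the power
  have hsplit : L ^ (-a) = L ^ (-(a - 3.1)) * (L ^ (-(1.1 : ℝ)) * L ^ (-(2 : ℝ))) := by
    rw [← Real.rpow_add hL0, ← Real.rpow_add hL0]; ring_nf
  have hcancel : L ^ (1.1 : ℝ) * L ^ (-(1.1 : ℝ)) = 1 := by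
    rw [← Real.rpow_add hL0]; norm_num
  have hinv : L ^ (a - 3.1) * L ^ (-(a - 3.1)) = 1 := by
    rw [← Real.rpow_add hL0]; norm_num
  have hL2 : L ^ (-(2 : ℝ)) = (L ^ 2)⁻¹ := by
    rw [Real.rpow_neg hL0.le, Real.rpow_two]
  have hnum : K * (3 + L ^ (1.1 : ℝ)) * L ^ (-a) ≤ ε * π * (L ^ 2)⁻¹ := by
    have hpos1 : 0 ≤ L ^ (-(a - 3.1)) := Real.rpow_nonneg hL0.le _
    have hpos2 : 0 ≤ L ^ (-(2 : ℝ)) := Real.rpow_nonneg hL0.le _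
    calc K * (3 + L ^ (1.1 : ℝ)) * L ^ (-a)
        ≤ K * (4 * L ^ (1.1 : ℝ)) * L ^ (-a) := by
          gcongr
      _ = 4 * K * (L ^ (1.1 : ℝ) * L ^ (-(1.1 : ℝ))) * L ^ (-(a - 3.1)) * L ^ (-(2 : ℝ)) := by
          rw [hsplit]; ring
      _ = 4 * K * L ^ (-(a - 3.1)) * L ^ (-(2 : ℝ)) := by rw [hcancel]; ring
      _ ≤ (ε * π * L ^ (a - 3.1)) * L ^ (-(a - 3.1)) * L ^ (-(2 : ℝ)) := by gcongr
      _ = ε * π * (L ^ (a - 3.1) * L ^ (-(a - 3.1))) * L ^ (-(2 : ℝ)) := by ring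
      _ = ε * π * (L ^ 2)⁻¹ := by rw [hinv, hL2]; ring
  have hl7 : 0 < L ^ 7 := by positivity
  calc K * (3 + L ^ (1.1 : ℝ)) * L ^ (-a) / L ^ 7 ≤ ε * π * (L ^ 2)⁻¹ / L ^ 7 :=
        div_le_div_of_nonneg_right hnum hl7.le
    _ = ε * π / L ^ 9 := by field_simp

/-- **`Mid1225` from ANY `n`-sum bound `‖sum122‖ ≤ C·𝓛^{−a}·(dr/φ(dr))⁴` with a real exponent
`a > 3.1`** (for `c′ ≥ 0`) — the sharpest form of the edge the printed budget allows: with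
`‖m-sum‖ ≤ K_M𝓛⁻⁷` (`norm_mSum12_le`, Lemma 8.2 + `|L′(1,χ)| ≤ 4e^{9/2}𝓛²`) and the exact
logarithmic length `log T = 𝓛^{1.1}` of the range (`sum_mid_weights_le'`), the middle range of
`S_j(𝐚₁₂,𝐚₂₅)` is `≤ 4K_M C e^{1024}·𝓛^{1.1−7−a} = o(𝓛⁻⁹) = o(α)` exactly when `a > 3.1`. In
particular the head `l ≤ P″₁/dr < T` of the `n`-sum, bounded crudely by
`XiZeroMajorant.xiZeroTailMean_logFree` (`≤ C(1 + log T)⁴/log P₁ ≍ 𝓛^{−4.6}`), fits with `a = 4`.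
Any of the readings of (12.11) implies the hypothesis (typed `Eq1211`: `a = 8`; `α₁`-reading:
`a = 7.9`; the derivable weak forms `a ∈ (3.1, 6.8]`). [cite: Zhang2022LandauSiegel, §12 (12.12) p.71, tex L3605; Lemma 12.2 (12.11) p.70] -/
theorem mid1225_of_sum122_bound (hc' : 0 ≤ c')
    (h1211 : ∃ C a : ℝ, 3.1 < a ∧ ForAllLarge fun D _ χ => AssumptionA D χ →
      ∀ j ∈ ({1, 2, 3} : Finset ℕ), ∀ d r : ℕ, 1 ≤ d → 1 ≤ r →
        P1pp D / bigT D < ((d * r : ℕ) : ℝ) → ((d * r : ℕ) : ℝ) ≤ P1pp D →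
          ‖sum122 c' χ j d r‖ ≤
            C * ell D ^ (-a) * ((((d * r : ℕ) : ℝ)) / Nat.totient (d * r)) ^ 4) :
    Mid1225 c' := by
  classical
  intro ε hε
  obtain ⟨C82, D82, H82⟩ := lemma82_holds hc'
  obtain ⟨CN, a, ha, DN, HN⟩ := h1211
  -- constants
  obtain ⟨F0, hF0⟩ : ∃ F0 : ℝ, F0 = 1 + (5 / 2 + 3 * (1 + 5 * |c'| * π)) * π := ⟨_, rfl⟩
  have hF00 : 0 ≤ F0 := by rw [hF0]; positivity
  obtain ⟨C82', hC82'⟩ : ∃ C82' : ℝ, C82' = max C82 0 := ⟨_, rfl⟩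
  have hC82'0 : 0 ≤ C82' := by rw [hC82']; exact le_max_right _ _
  have hC82le : C82 ≤ C82' := by rw [hC82']; exact le_max_left _ _
  obtain ⟨CN', hCN'⟩ : ∃ CN' : ℝ, CN' = max CN 0 := ⟨_, rfl⟩
  have hCN'0 : 0 ≤ CN' := by rw [hCN']; exact le_max_right _ _
  have hCNle : CN ≤ CN' := by rw [hCN']; exact le_max_left _ _
  obtain ⟨KM, hKM⟩ : ∃ KM : ℝ,
      KM = (5 / 4 / 0.498 + 23 / 10 / 0.4) * (4 * Real.exp (9 / 2) * F0 + C82') := ⟨_, rfl⟩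
  have hKM0 : 0 ≤ KM := by rw [hKM]; positivity
  obtain ⟨L1, hL1⟩ : ∃ L1 : ℝ,
      L1 = (4 * (KM * CN' * Real.exp 1024) / (ε * π)) ^ (1 / (a - 3.1)) := ⟨_, rfl⟩
  obtain ⟨L0, hL0⟩ : ∃ L0 : ℝ, L0 = max 5 L1 := ⟨_, rfl⟩
  refine ⟨max (max D82 DN) ⌈Real.exp L0⌉₊, fun D _ χ hD hq hp hA a25 ha25 j hj => ?_⟩
  have hD82 : D82 ≤ D := (le_max_left _ _).trans ((le_max_left _ _).trans hD)
  have hDN : DN ≤ D := (le_max_right _ _).trans ((le_max_left _ _).trans hD)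
  have hℓL0 : L0 ≤ ell D := le_ell_of_ceil_exp_le (le_of_max_le_right hD)
  have hℓ5 : 5 ≤ ell D := by rw [hL0] at hℓL0; exact (le_max_left _ _).trans hℓL0
  have hℓL1 : L1 ≤ ell D := by rw [hL0] at hℓL0; exact (le_max_right _ _).trans hℓL0
  have hℓ3 : 3 ≤ ell D := by linarith
  have h1 : 1 ≤ ell D := by linarith
  have h0 : 0 < ell D := by linarith
  have hD3 : 3 ≤ Real.log D := by rwa [ell] at hℓ3
  have H82D := H82 D χ hD82 hq hp hA j hj
  have HND := HN D χ hDN hq hp hA j hj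
  -- the `m`-sum per `(n/r, r)`
  have hM : ∀ n : ℕ, 1 ≤ n → (n : ℝ) ≤ P1pp D → ∀ r ∈ n.divisors,
      ‖∑ m ∈ Finset.Ico 1 (Nsupp D), a12 χ (n / r * r * m) / (m : ℂ) ^ (1 - betaJ c' D j)‖ ≤
        KM / ell D ^ 7 := by
    intro n hn hnP r hr
    have hrn : r ∣ n := Nat.dvd_of_mem_divisors hr
    have hr1 : 1 ≤ r := Nat.pos_of_mem_divisors hr
    have hdr : n / r * r = n := Nat.div_mul_cancel hrn
    have hd1 : 1 ≤ n / r := Nat.div_pos (Nat.le_of_dvd hn hrn) hr1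
    have hdrR : ((n / r * r : ℕ) : ℝ) = n := by rw [hdr]
    have hdrP : ((n / r * r : ℕ) : ℝ) ≤ P1pp D := by rw [hdrR]; exact hnP
    obtain ⟨⟨hy3T, hy3P⟩, ⟨hy2T, hy2P⟩⟩ := mid_windows hℓ5 hn hnP
    rw [← hdrR] at hy3T hy3P hy2T hy2P
    have h6 := (H82D 6 (by simp) _ hy3T hy3P).trans
      (mul_le_mul_of_nonneg_right hC82le (by positivity))
    have h7 := (H82D 7 (by simp) _ hy2T hy2P).trans
      (mul_le_mul_of_nonneg_right hC82le (by positivity))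
    have key := norm_mSum12_le c' χ hℓ5 hp hC82'0 j hd1 hr1 hdrP h6 h7
    rw [← hF0, ← hKM] at key
    rw [mSum_a12_eq]
    calc ‖χ ((n / r : ℕ) : ZMod D) * χ (r : ZMod D) * mSum12 c' χ j (n / r) r‖
        ≤ 1 * 1 * (KM / ell D ^ 7) := by
          rw [norm_mul, norm_mul]
          gcongr
          · exact χ.norm_le_one _
          · exact χ.norm_le_one _
      _ = KM / ell D ^ 7 := by ring
  -- the `n`-sum per `(n/r, r)`, from the hypothesis
  have hN : ∀ n : ℕ, 1 ≤ n → P1pp D / bigT D < (n : ℝ) → (n : ℝ) ≤ P1pp D → ∀ r ∈ n.divisors,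
      ‖∑ m ∈ Finset.Ico 1 (Nsupp D), a25 (n / r * r * m) * xiZero c' D j m (n / r) r / (m : ℂ)‖ ≤
        CN' * ell D ^ (-a) * (((n : ℝ) / Nat.totient n) ^ 4) := by
    intro n hn hnlo hnP r hr
    have hrn : r ∣ n := Nat.dvd_of_mem_divisors hr
    have hr1 : 1 ≤ r := Nat.pos_of_mem_divisors hr
    have hdr : n / r * r = n := Nat.div_mul_cancel hrn
    have hd1 : 1 ≤ n / r := Nat.div_pos (Nat.le_of_dvd hn hrn) hr1
    have hdrR : ((n / r * r : ℕ) : ℝ) = n := by rw [hdr]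
    have key := HND (n / r) r hd1 hr1 (by rw [hdrR]; exact hnlo) (by rw [hdrR]; exact hnP)
    rw [hdr] at key
    have hρa : 0 ≤ ell D ^ (-a) := Real.rpow_nonneg h0.le _
    rw [nSum_a25_eq_sum122 c' χ hD3 hq a25 ha25 j hd1 hr1]
    calc ‖χ ((n / r : ℕ) : ZMod D) * χ (r : ZMod D) * sum122 c' χ j (n / r) r‖
        ≤ 1 * 1 * (CN * ell D ^ (-a) * (((n : ℝ) / Nat.totient n) ^ 4)) := by
          rw [norm_mul, norm_mul]
          refine mul_le_mul (mul_le_mul (χ.norm_le_one _) (χ.norm_le_one _) (norm_nonneg _)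
            zero_le_one) key (norm_nonneg _) (by norm_num)
      _ ≤ 1 * 1 * (CN' * ell D ^ (-a) * (((n : ℝ) / Nat.totient n) ^ 4)) := by gcongr
      _ = CN' * ell D ^ (-a) * (((n : ℝ) / Nat.totient n) ^ 4) := by ring
  -- assemble
  rw [SjOn_mid_eq c' χ hℓ5 j a25]
  set F : Finset ℕ := (Finset.Ico 1 (Nsupp D)).filter (rngMid D) with hF
  have hFmem : ∀ n ∈ F, 1 ≤ n ∧ P1pp D / bigT D < (n : ℝ) ∧ (n : ℝ) ≤ P1pp D := by
    intro n hn
    rw [hF, Finset.mem_filter, Finset.mem_Ico] at hn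
    exact ⟨hn.1.1, hn.2.1, hn.2.2⟩
  have hρa : 0 ≤ ell D ^ (-a) := Real.rpow_nonneg h0.le _
  have hper : ∀ n ∈ F, ∑ r ∈ n.divisors,
      ‖(((ArithmeticFunction.moebius r).natAbs : ℕ) : ℂ) * lamZero c' D j (n / r * r) /
            (((n / r * r : ℕ) : ℂ) * (Nat.totient r : ℂ)) *
          (∑ m ∈ Finset.Ico 1 (Nsupp D), a12 χ (n / r * r * m) / (m : ℂ) ^ (1 - betaJ c' D j)) *
          (∑ m ∈ Finset.Ico 1 (Nsupp D),
            a25 (n / r * r * m) * xiZero c' D j m (n / r) r / (m : ℂ))‖ ≤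
      ((n : ℝ) / Nat.totient n) ^ 9 / n * (KM / ell D ^ 7) * (CN' * ell D ^ (-a)) := by
    intro n hn
    obtain ⟨hn1, hnlo, hnP⟩ := hFmem n hn
    have hn0 : n ≠ 0 := by omega
    have hρ : 0 ≤ (n : ℝ) / Nat.totient n := by positivity
    calc ∑ r ∈ n.divisors,
          ‖(((ArithmeticFunction.moebius r).natAbs : ℕ) : ℂ) * lamZero c' D j (n / r * r) /
                (((n / r * r : ℕ) : ℂ) * (Nat.totient r : ℂ)) *
              (∑ m ∈ Finset.Ico 1 (Nsupp D), a12 χ (n / r * r * m) / (m : ℂ) ^ (1 - betaJ c' D j)) *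
              (∑ m ∈ Finset.Ico 1 (Nsupp D),
                a25 (n / r * r * m) * xiZero c' D j m (n / r) r / (m : ℂ))‖
        ≤ ∑ r ∈ n.divisors, (if Squarefree r then 1 / (Nat.totient r : ℝ) else 0) *
            (((n : ℝ) / Nat.totient n) ^ 4 / n) * (KM / ell D ^ 7) *
            (CN' * ell D ^ (-a) * (((n : ℝ) / Nat.totient n) ^ 4)) := by
          refine Finset.sum_le_sum fun r hr => ?_
          have hrn : r ∣ n := Nat.dvd_of_mem_divisors hr
          have hr0 : r ≠ 0 := (Nat.pos_of_mem_divisors hr).ne'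
          have hdr : n / r * r = n := Nat.div_mul_cancel hrn
          have hw := norm_weight_le c' (D := D) j hn0 hr0
          have hw' : ‖(((ArithmeticFunction.moebius r).natAbs : ℕ) : ℂ) * lamZero c' D j (n / r * r) /
              (((n / r * r : ℕ) : ℂ) * (Nat.totient r : ℂ))‖ ≤
              (if Squarefree r then 1 / (Nat.totient r : ℝ) else 0) *
                (((n : ℝ) / Nat.totient n) ^ 4 / n) := by
            rw [hdr]; exact hw
          rw [norm_mul, norm_mul]
          have hMv : 0 ≤ KM / ell D ^ 7 := by positivity
          have hMn := hM n hn1 hnP r hr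
          have hNn := hN n hn1 hnlo hnP r hr
          gcongr
      _ = (∑ r ∈ n.divisors with Squarefree r, (1 / (Nat.totient r : ℝ))) *
            ((((n : ℝ) / Nat.totient n) ^ 4 / n) * (KM / ell D ^ 7) *
              (CN' * ell D ^ (-a) * (((n : ℝ) / Nat.totient n) ^ 4))) := by
          rw [Finset.sum_filter, Finset.sum_mul]
          refine Finset.sum_congr rfl fun r _ => ?_
          split_ifs <;> ring
      _ = ((n : ℝ) / Nat.totient n) ^ 9 / n * (KM / ell D ^ 7) * (CN' * ell D ^ (-a)) := by
          rw [sum_sqfree_divisors_inv_totient hn0]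
          ring
  have hweights := sum_mid_weights_le' (D := D) hℓ5 F (fun n hn => (hFmem n hn).2)
  have hαeq : alpha D = π / ell D ^ 9 := Section2.alpha_eq_pi_div_ell9 D
  have hfin := closing_bound_rpow (K := KM * CN' * Real.exp 1024) (by positivity) hε h1 ha
    (by rw [hL1] at hℓL1; exact hℓL1)
  calc ‖∑ n ∈ F, ∑ r ∈ n.divisors,
          (((ArithmeticFunction.moebius r).natAbs : ℕ) : ℂ) * lamZero c' D j (n / r * r) /
              (((n / r * r : ℕ) : ℂ) * (Nat.totient r : ℂ)) *
            (∑ m ∈ Finset.Ico 1 (Nsupp D), a12 χ (n / r * r * m) / (m : ℂ) ^ (1 - betaJ c' D j)) *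
            (∑ m ∈ Finset.Ico 1 (Nsupp D),
              a25 (n / r * r * m) * xiZero c' D j m (n / r) r / (m : ℂ))‖
      ≤ ∑ n ∈ F, ‖∑ r ∈ n.divisors,
          (((ArithmeticFunction.moebius r).natAbs : ℕ) : ℂ) * lamZero c' D j (n / r * r) /
              (((n / r * r : ℕ) : ℂ) * (Nat.totient r : ℂ)) *
            (∑ m ∈ Finset.Ico 1 (Nsupp D), a12 χ (n / r * r * m) / (m : ℂ) ^ (1 - betaJ c' D j)) *
            (∑ m ∈ Finset.Ico 1 (Nsupp D),
              a25 (n / r * r * m) * xiZero c' D j m (n / r) r / (m : ℂ))‖ := norm_sum_le _ _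
    _ ≤ ∑ n ∈ F, ∑ r ∈ n.divisors,
          ‖(((ArithmeticFunction.moebius r).natAbs : ℕ) : ℂ) * lamZero c' D j (n / r * r) /
              (((n / r * r : ℕ) : ℂ) * (Nat.totient r : ℂ)) *
            (∑ m ∈ Finset.Ico 1 (Nsupp D), a12 χ (n / r * r * m) / (m : ℂ) ^ (1 - betaJ c' D j)) *
            (∑ m ∈ Finset.Ico 1 (Nsupp D),
              a25 (n / r * r * m) * xiZero c' D j m (n / r) r / (m : ℂ))‖ :=
        Finset.sum_le_sum fun n _ => norm_sum_le _ _
    _ ≤ ∑ n ∈ F, ((n : ℝ) / Nat.totient n) ^ 9 / n * (KM / ell D ^ 7) * (CN' * ell D ^ (-a)) :=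
        Finset.sum_le_sum hper
    _ = (KM / ell D ^ 7) * (CN' * ell D ^ (-a)) * ∑ n ∈ F, ((n : ℝ) / Nat.totient n) ^ 9 / n := by
        rw [Finset.mul_sum]
        refine Finset.sum_congr rfl fun n _ => ?_
        ring
    _ ≤ (KM / ell D ^ 7) * (CN' * ell D ^ (-a)) * (Real.exp 1024 * (3 + ell D ^ (1.1 : ℝ))) := by
        gcongr
    _ = KM * CN' * Real.exp 1024 * (3 + ell D ^ (1.1 : ℝ)) * ell D ^ (-a) / ell D ^ 7 := by
        field_simp
    _ ≤ ε * π / ell D ^ 9 := hfin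
    _ = ε * alpha D := by rw [hαeq]; ring

/-- **`Mid1225` from the `n`-sum bound `‖sum122‖ ≤ C·𝓛⁻⁴·(dr/φ(dr))⁴`** (`c′ ≥ 0`): the natural-power
instance `a = 4` of `mid1225_of_sum122_bound` — the form a crude treatment of (12.11) delivers (long
part `l < P″₂/dr` by the relative Lemma 8.4 plus an `O(𝓛⁻⁴(dr/φ(dr))⁴)`-bound for the log-free
twisted sum `Σ_{l<P″₂/dr} χ(l)ξ₀ⱼ(l;d,r)l^{β₆−1}`; head `l ≤ P″₁/dr < T` by
`XiZeroMajorant.xiZeroTailMean_logFree`, `≍ 𝓛^{−4.6}`). [cite: Zhang2022LandauSiegel, §12 (12.12) p.71, tex L3605; Lemma 12.2 (12.11) p.70] -/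
theorem mid1225_of_eq1211_weak4 (hc' : 0 ≤ c')
    (h1211 : ∃ C : ℝ, ForAllLarge fun D _ χ => AssumptionA D χ →
      ∀ j ∈ ({1, 2, 3} : Finset ℕ), ∀ d r : ℕ, 1 ≤ d → 1 ≤ r →
        P1pp D / bigT D < ((d * r : ℕ) : ℝ) → ((d * r : ℕ) : ℝ) ≤ P1pp D →
          ‖sum122 c' χ j d r‖ ≤
            C * (ell D ^ 4)⁻¹ * ((((d * r : ℕ) : ℝ)) / Nat.totient (d * r)) ^ 4) :
    Mid1225 c' := by
  refine mid1225_of_sum122_bound c' hc' ?_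
  obtain ⟨C, D₀, h⟩ := h1211
  refine ⟨C, 4, by norm_num, D₀, fun D _ χ hD hq hp hA j hj d r hd hr hlo hhi => ?_⟩
  have key := h D χ hD hq hp hA j hj d r hd hr hlo hhi
  have e : ell D ^ (-(4 : ℝ)) = (ell D ^ 4)⁻¹ := by
    rw [Real.rpow_neg (by rw [ell]; exact Real.log_natCast_nonneg D), show (4 : ℝ) = (4 : ℕ) by
      norm_num, Real.rpow_natCast]
  rw [e]
  exact key

end EdgeRpow

end Literature.NumberTheory.LFunctions.Zhang2022.Typed.Sec12C
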